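import Literature.Claims.NS.ClayVariants
import Literature.Analysis.FluidPDE.ClassicalSolution
import Mathlib.Analysis.Convex.Function
import HarnessLib

/-!
# Claim skeleton: X. Xu (2024/2026), «Large data existence of global-in-time strong solutions to
# the incompressible Navier–Stokes equations in high space dimensions»

Cell `ns-claims` (D-0090 NS-CLAIMS SWEEP), claim C10, typist `ns-claims-typist-10` (refuter-5, ref-4,
sources lit-4). UNREFEREED CLAIM under adjudication — NOTHING in this file asserts a step: every
`Step_k` is a `Prop` (a printed assertion of the paper, typed as an implication «standing hypotheses
∧ the earlier displays its printed proof invokes → the display», so that `¬ Step_k` or its vacuity is a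
kernel statement for the refuter's `SoloRefuteXu2024.lean`); the only `theorem`s are the kernel
COMPOSITION of the paper's own implications and small positivity/unfolding lemmas.

Version of record: arXiv:2401.17147 **v18** (2026-07-22), 22 pp. [Xu2024NSLinfty]; print page = PDF
page; equation numbers as printed in v18 (pages `pub/ns-claims/sources/Xu2024/v18-pages/`, TeX labels
and the version drift v1/v12/v13/v16/v17/v18 in `sources/Xu2024/LOCATORS.md` §5, ns-claims-lit-4: the
largest-root device (3.67)–(3.73) typed below first appears in v17; v1–v16 close the exponent
bookkeeping differently). 18 arXiv versions, no journal reference, no public localisation found.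

## Claimed statement (as printed)

Theorem 1.1, p. 1: «Assume that (1.4) |v⁽⁰⁾| ≡ √((v₁⁽⁰⁾)² + ⋯ + (v_N⁽⁰⁾)²) ∈ L²(ℝᴺ) ∩ L^∞(ℝᴺ) and
∇·v⁽⁰⁾ = 0. Let (v, p) be a local (in-time) strong solution to (1.1)-(1.3). Then there exist a
positive number c = c(N, ν, ‖v⁽⁰⁾‖_{2,ℝᴺ}, ‖v⁽⁰⁾‖_{∞,ℝᴺ}) such that (1.5) ‖v‖_{∞,Q_T} ≤
c(N, ν, ‖v⁽⁰⁾‖_{2,ℝᴺ}, ‖v⁽⁰⁾‖_{∞,ℝᴺ}).», with (1.1)–(1.3) the unforced Navier–Stokes system in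
`Q_T = ℝᴺ × (0,T)`, «given T, ν ∈ (0,∞)», `N ≥ 3` (p. 1). p. 2: «A result of [18] asserts that a
local (in-time) strong solution to (1.1)-(1.3) does exist under (1.4). Since the upper bound in (1.5)
does not depend on T, our theorem asserts that a local (in-time) strong solution never develops
singularity. As a result, it can be extended for all time. This yields a positive answer to the
Navier-Stokes millennium problem.» p. 7: «a strong solution over a time interval is also smooth
there [18]. Therefore … we may assume that (u,p) is a classical solution … we show that if (3.1)
|v| ∈ L^∞(Q_T), then (1.5) must be true.»
Typed: `ClaimedTheorem` = Theorem 1.1 for classical solutions on `ℝᴺ × [0,T]` bounded on `Q_T`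
((3.1)), with the printed quantifier order (`c` a FUNCTION of `(‖v⁰‖₂, ‖v⁰‖_∞)` chosen after `N, ν`
and before `T` and the solution — «does not depend on T», p. 2); the Millennium sentence of p. 2 is
`clay_of_claimed_of_delta` with `ClayDelta := Step_15` (the continuation step the paper cites to [18]).

## Clay delta (reference `ClayVariants.lean`, Δ-axes of its §3)

Nearest: (A) `ClayVariants.clayR3.Regularity`. Δ1 DOMAIN: ℝᴺ, every N ≥ 3 (N = 3 instance used) =
· Δ2 EQUATIONS: NS, ν > 0 fixed = · Δ3 FORCE: none = · Δ4 DATA: |v⁰| ∈ L² ∩ L^∞ ⊇ Clay (4) (larger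
class: the good direction) · Δ5 SOLUTION NOTION: «local strong solution», typed as classical on
`ℝᴺ × [0,T]` and bounded (3.1), pressure in `L^s(ℝᴺ)`, `s > 1` (the Newtonian-potential normalisation
of p. 5: «∫ p dx = 0 … Calderón–Zygmund») · Δ6 FORM OF THE CONCLUSION: an a-priori `L^∞(Q_T)` bound
uniform in `T` + continuation, STRONGER than (A) modulo the classical last mile `Step_15` (local
smooth solution from a Clay datum with the `L^∞` blow-up alternative, Leray 1934 via [18]) · Δ7: all
ν, all T · Δ8 n/a. Not a «wrong problem» candidate: `ClayDelta` is a classical theorem, recorded as the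
paper's own Step 15 (p. 2, p. 7, p. 21), not an unproved hypothesis of the Millennium statement.

## Steps (dependency order = the ordered index of TYPING-HYGIENE 11; u := v − w, f(r) := ln ∫_{Q_T}|u|^r)

* Step 1 = `Step_1` — Lemma 3.1 (3.2) p. 7 with (3.7)–(3.9) p. 8–9 and «|u| ∈ Lʳ(Q_T) for each
  r ≥ 2λ_N» p. 9: the transport–diffusion companion `w` of (1.20)–(1.21) exists and the energy-class
  bounds hold with `c(N,ν)` independent of `T` — classical.
* Step 2 = `Step_2` — Lemma 3.2 (3.6) p. 8: `‖p(·,t)‖_s ≤ c(s,N)‖v(·,t)‖²_{2s}` (Calderón–Zygmund) — classical.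
* Step 3 = `Step_3` — (3.10)–(3.14) p. 9 with (1.19) p. 4, (1.27)–(1.28) p. 5: `f` is smooth and convex
  on `(2λ_N,∞)`, `f′ ≤ ln‖u‖_∞`, `f(r)/r → ln‖u‖_∞`, endpoint interpolation — true (log-convexity).
* Step 4 = `Step_4` — (1.7)/(1.16) p. 2–4: the linear De Giorgi bound
  `‖v‖_∞ ≤ 2√N‖v⁰‖_∞ + c(N,ν,q)‖v⁰‖₂ + c(N,q)‖v‖²_{2q,Q_T}`, `q > N+2` — plausible (standard).
* Step 5 = `Step_5` — Proof of Thm 1.1, (3.15)–(3.44) pp. 9–14 (De Giorgi for `φ = u/‖u‖_r` with the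
  level condition (3.33), «the new idea», p. 5): under (3.43) the bound (3.44) for all `j > 0`,
  `r > max(2λ_N, 2j)`, `ℓ > r` — typed in logarithms (`Ineq344`); typist's pre-registered PREDICTED
  locator (CARD §4); no pointwise error found on reading.
* Step 6 = `Step_6` — the other branch of (3.43), p. 14–15: if `‖w‖_{2q} ≥ ‖u‖_{2q}` then (1.5) via (1.16) — true arithmetic.
* Step 7 = `Step_7` — glue «this implies (1.5)» (p. 16 l.−8, p. 19, p. 21) with (3.9): a bound on
  `ln‖u‖_∞` by `f(2λ_N)` yields a pointwise bound on `v` — true arithmetic (implicit step, typed so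
  that the composition stays logic).
* Step 8 = `Step_8` — Claim 3.3 (3.45)–(3.48) p. 15 — true given its inputs (checked by hand).
* Step 9 = `Step_9` — the other branches of the reductions (3.53) p. 16, (3.54) p. 16–17, (3.65) p. 19:
  each yields (1.5) through (3.46) — true given (3.46).
* Step 10 = `Step_10` — (3.57)–(3.61) p. 17–18 and (3.66) p. 19 (interpolation (3.59), `ℓ → r⁺`,
  elimination of `8√N` by (3.65)) — true given its inputs (checked by hand).
* Step 11 = `Step_11` — (3.67)–(3.69) and the second half of (3.70) with (3.71), p. 19–20: for each
  `ε ∈ (0,1)` the largest root `r_ε` of `h(s) = (1+ε) ln‖u‖_∞` exists and `h′(r_ε) ≤ 0` — true.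
* Step 12 = `Step_12` — FIRST HALF OF (3.70), p. 19–20: «r_ε → ∞ as ε → 0⁺» (printed proof p. 20:
  «This combined with (3.67) implies that r₀ > 2j … contradicts (3.54). Thus r₀ = ∞») — the referee's
  pre-read candidate (RETYPE.md: under (3.54) and (1.28) every root lies below `2j/(1 − (1+ε)^{−1/ε})`).
* Step 13 = `Step_13` — (3.72)–(3.74) and «Pass to the limit in (3.73)», p. 20–21: the final bound
  `‖u‖_∞ ≤ c(N,ν,q,j,η)‖u‖_{2λ_N}^{c(N,q,j,η)}` — true GIVEN `r_ε → ∞` (checked by hand).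
* Step 14 = `Step_14` — parameter bookkeeping (3.29), (3.49)–(3.52) p. 12, 15–16, (3.60), (3.62)–(3.64)
  p. 18–19, (3.74) and «the order in which we pick our parameters» p. 21 — true arithmetic.
* Step 15 = `Step_15` (= `ClayDelta`) — p. 2 l. 10–13, p. 7 l. 22–26, p. 21 l. 58–59 with [18]: local
  smooth solution from a Clay datum with the `L^∞` blow-up alternative — classical (Leray 1934).
Ordered index: Step 1 = `Step_1` (L. 3.1, p. 7–9) · Step 2 = `Step_2` (L. 3.2, p. 8) · Step 3 = `Step_3`
((3.10)–(3.14), p. 9) · Step 4 = `Step_4` ((1.16), p. 4) · Step 5 = `Step_5` ((3.15)–(3.44), pp. 9–14) ·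
Step 6 = `Step_6` ((3.43) else-branch, p. 15) · Step 7 = `Step_7` (glue, (3.9) p. 9 / p. 21) · Step 8 =
`Step_8` (Claim 3.3, p. 15) · Step 9 = `Step_9` ((3.53)/(3.54)/(3.65) else-branches, pp. 16–17, 19) ·
Step 10 = `Step_10` ((3.57)–(3.66), pp. 17–19) · Step 11 = `Step_11` ((3.69)–(3.71), pp. 19–20) · Step 12
= `Step_12` ((3.70) first half, p. 20) · Step 13 = `Step_13` ((3.72)–(3.74), pp. 20–21) · Step 14 =
`Step_14` (parameters, pp. 12–21) · Step 15 = `Step_15` (continuation, p. 2/7/21).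

## COMPOSITION — proved as `claim_of_steps : Step_1 → … → Step_14 → ClaimedTheorem`

The printed logic composes: the kernel proof is the paper's case analysis (‖u‖_∞ ≤ 1 or not, p. 19;
the dichotomies (3.43) p. 14, (3.53), (3.54) p. 16, (3.65) p. 19) followed by modus ponens along
Steps 5 → 8 → 10 → 11 → 12 → 13 → 7, the constant `c(N,ν,·,·)` of (1.5) being the maximum of the six
printed branch bounds (with `η := 1`, `q, j` from Step 14). `clay_of_claimed_of_delta : Step_15 →
ClaimedTheorem → clayR3.Regularity` is the p. 2 sentence. `step_12_NS_of_steps` records that the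
solution-level reading of (3.70) is Step 12 instantiated through Step 3. DISCHARGED (D-0026,
append-only section at the end; nothing above it changed): `step7_holds : Step_7`, `step6_holds : Step_6`
(2026-08-27).

Design. Physical space `EuclideanSpace ℝ (Fin N)`; solutions are the tree's
`IsClassicalNSSolutionOn (Icc 0 T) ν 0 v p`; `‖·‖_{r,Q_T}` is the Bochner integral `qInt` (finite by
Step 1, TYPING-HYGIENE 2), `‖·‖_{∞,Q_T}` the supremum `supQ` (a true supremum under (3.1), hygiene 1;
the conclusion (1.5) is typed pointwise), `‖v⁰‖₂`, `‖v⁰‖_∞` are `eLpNorm`s. From (3.44) on, the printed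
argument manipulates only the numbers `f(r)`, `f′(r)`, `ln‖u‖_∞` and constants (the author's own
reformulation (1.27)–(1.28), p. 5: «We solve the third case via suitable applications of various
properties of f(r). This constitutes the core of our development»); Steps 8–13 are therefore typed over
an arbitrary `f : ℝ → ℝ` and `L : ℝ` carrying exactly the printed properties (`FSetting`: (3.11),
(3.13), (3.14)/(1.28), (1.19), (3.44), ‖u‖_∞ > 1, the parameter regime) — FAILURE-MODES F15 — and the
composition instantiates them at `f = fLog T u`, `L = ln (supQ T u)` via Steps 3 and 5. The largest
root `r_ε` is the predicate `IsLargestRoot` (not an `∃`-root, RETYPE F3) and «r_ε → ∞ as ε → 0⁺» is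
`RootDivergence_asPrinted` (`Tendsto rε (𝓝[>] 0) atTop` for every selection of largest roots) — both,
with `hfun` and `Premises`, the ref-4 / refuter-5 scaffold texts VERBATIM (TYPING-HYGIENE 13), so the
refuter's kernel theorem ports by renaming. (3.43), (3.53), (3.54), (3.65) are typed at the one `q ∈
[q₀, 2q₀]` fixed on p. 21 («We first choose q as in (3.51)»); their printed «for each q ∈ [q₀,2q₀]»
generality is consumed nowhere downstream. No `instance`, no `notation`; nothing is asserted or postulated.

WHAT THIS IS NOT: not a claim about NS regularity or blow-up; not a claim about any author beyond the
typed locator.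
-/

open MeasureTheory Set Filter
open scoped ContDiff Topology Laplacian InnerProductSpace

namespace Literature.Claims.NS.Xu2024

open Literature.Analysis.FluidPDE

noncomputable section

/-! ## Vocabulary (definitions with bodies; nothing asserted) -/

/-- Physical space `ℝᴺ` («in the whole space ℝᴺ, N ≥ 3», p. 1). [cite: Xu2024NSLinfty, §1 p.1] -/
abbrev Euc (N : ℕ) : Type := EuclideanSpace ℝ (Fin N)

/-- `∫_{Q_T} |g|ʳ dx dt` for a field `g` on `Q_T = ℝᴺ × (0,T)` (Bochner integral over
`[0,T] × ℝᴺ`; the true value whenever `|g|ʳ` is integrable, which Step 1 provides for `r ≥ 2λ_N`).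
`‖g‖_{r,Q_T} = (qInt T g r)^{1/r}` ((1.27) p. 5, (3.15) p. 9). [cite: Xu2024NSLinfty, (1.27) p.5] -/
def qInt {N : ℕ} (T : ℝ) (g : ℝ → Euc N → Euc N) (r : ℝ) : ℝ :=
  ∫ z in Icc (0 : ℝ) T ×ˢ (univ : Set (Euc N)), ‖g z.1 z.2‖ ^ r

/-- `‖g‖_{∞,Q_T}`: the supremum of `|g|` over `[0,T] × ℝᴺ` (a genuine supremum for the bounded
fields of (3.1) p. 7 and (3.7) p. 8; `|·|` is the Euclidean norm of (1.4)). [cite: Xu2024NSLinfty, (3.1) p.7] -/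
def supQ {N : ℕ} (T : ℝ) (g : ℝ → Euc N → Euc N) : ℝ :=
  sSup ((fun z : ℝ × Euc N => ‖g z.1 z.2‖) '' (Icc (0 : ℝ) T ×ˢ univ))

/-- `‖v⁰‖_{2,ℝᴺ} = (∫ |v⁰|² dx)^{1/2}` (Theorem 1.1, p. 1–2). [cite: Xu2024NSLinfty, Thm 1.1 p.1] -/
def dataL2 {N : ℕ} (v₀ : Euc N → Euc N) : ℝ := (eLpNorm v₀ 2 volume).toReal

/-- `‖v⁰‖_{∞,ℝᴺ}` (essential supremum of `|v⁰|`; Theorem 1.1, p. 1). [cite: Xu2024NSLinfty, Thm 1.1 p.1] -/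
def dataLinf {N : ℕ} (v₀ : Euc N → Euc N) : ℝ := (eLpNorm v₀ ⊤ volume).toReal

/-- `u = v − w` ((1.22) p. 4). [cite: Xu2024NSLinfty, (1.22) p.4] -/
def vsub {N : ℕ} (v w : ℝ → Euc N → Euc N) : ℝ → Euc N → Euc N := fun t x => v t x - w t x

/-- `f(r) = ln(∫_{Q_T} |u|ʳ dx dt)`, `r ≥ 2λ_N` ((1.27) p. 5). [cite: Xu2024NSLinfty, (1.27) p.5] -/
def fLog {N : ℕ} (T : ℝ) (u : ℝ → Euc N → Euc N) (r : ℝ) : ℝ := Real.log (qInt T u r)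

/-- `λ_N = (N+2)/N` ((1.12) p. 3). [cite: Xu2024NSLinfty, (1.12) p.3] -/
def lam (N : ℕ) : ℝ := ((N : ℝ) + 2) / N

/-- `α = 2(q−N−2)/(q(N+2))` ((3.31) p. 12). [cite: Xu2024NSLinfty, (3.31) p.12] -/
def alpha (N : ℕ) (q : ℝ) : ℝ := 2 * (q - N - 2) / (q * (N + 2))

/-- `m_q = 2(q−2λ_N)/(αq)` ((3.45) p. 15). [cite: Xu2024NSLinfty, (3.45) p.15] -/
def mq (N : ℕ) (q : ℝ) : ℝ := 2 * (q - 2 * lam N) / (alpha N q * q)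

/-- `c(N,q,j) = (2+jα)λ_N/(α(q−λ_N))`, so that `s₁ = c(N,q,j)/(r−2j)` ((3.42) p. 14). [cite: Xu2024NSLinfty, (3.42) p.14] -/
def cqj (N : ℕ) (q j : ℝ) : ℝ := (2 + j * alpha N q) * lam N / (alpha N q * (q - lam N))

/-- `c(N,q) = 2(1+jα)λ_N/(α(q−λ_N))` at `j = m_q/2`, the exponent numerator of (3.46)
(`s₀ = c(N,q)/(r−m_q)`, proof of Claim 3.3, p. 15). [cite: Xu2024NSLinfty, (3.46)–(3.48) p.15] -/
def cq (N : ℕ) (q : ℝ) : ℝ := (2 + mq N q * alpha N q) * lam N / (alpha N q * (q - lam N))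

/-- `c(N,ν,q,j)` of (3.41) p. 14 (with the factor `2^{4/α}` absorbed on p. 14 l.−6), as a function of
the De Giorgi constant `K₀ = c(N,ν,q)` of (3.30)/(3.36): `c₁ = [c(N,ν,q,j)]^{1/(r−2j)}`, independent
of `r`, `ℓ`. [cite: Xu2024NSLinfty, (3.41) p.14] -/
def Kconst (N : ℕ) (K₀ q j : ℝ) : ℝ :=
  2 ^ (4 / alpha N q) * K₀ * (4 * Real.sqrt N) ^ j * (8 * Real.sqrt N) ^ ((2 + j * alpha N q) / alpha N q)

/-- The bracket `−j + (j−m_q)(r−2q)/(2(q−λ_N))` of (3.61)/(3.63) p. 18. [cite: Xu2024NSLinfty, (3.63) p.18] -/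
def bracket (N : ℕ) (q j r : ℝ) : ℝ := -j + (j - mq N q) * (r - 2 * q) / (2 * (q - lam N))

/-- The final exponent `λ_N j/(q−λ_N) + 2λ_N − (2q m_q + η)/(2(q−λ_N))` of `‖u‖_∞` (p. 21, positive
under (3.74)). [cite: Xu2024NSLinfty, (3.74) p.21] -/
def theta (N : ℕ) (q j η : ℝ) : ℝ :=
  lam N * j / (q - lam N) + 2 * lam N - (2 * q * mq N q + η) / (2 * (q - lam N))

/-- `h(s) = f(s)/(s^{1−ε}(s−2j)^ε)` on `(2j,∞)` (p. 19). Text = ref-4's retype / refuter-5's scaffold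
`hfun` verbatim (TYPING-HYGIENE 13). [cite: Xu2024NSLinfty, p.19 after (3.66)] -/
def hfun (f : ℝ → ℝ) (j ε s : ℝ) : ℝ := f s / (s ^ (1 - ε) * (s - 2 * j) ^ ε)

/-- `r` IS `r_ε`, THE LARGEST SOLUTION in `(2j,∞)` of (3.69) `h(s) = (1+ε) ln‖u‖_∞` («Obviously, the
largest solution exists, and we denote it by r_ε», p. 19) — with `L` for `ln‖u‖_∞`. Text = ref-4's
retype / refuter-5's scaffold `IsLargestRoot` verbatim (TYPING-HYGIENE 13). [cite: Xu2024NSLinfty, (3.69) p.19] -/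
def IsLargestRoot (f : ℝ → ℝ) (L j ε r : ℝ) : Prop :=
  2 * j < r ∧ hfun f j ε r = (1 + ε) * L ∧ ∀ s, r < s → hfun f j ε s ≠ (1 + ε) * L

/-- «The paper's standing premises on f at p. 19–20» — EXACTLY what the printed proof of (3.70) invokes:
`ln‖u‖_∞ > 0` (p. 19 «We may assume that ‖u‖_{∞,Q_T} > 1»), `0 < q < j` ((3.64)), `f` differentiable
and convex on `[2q,∞)` ((3.11), «f is a smooth function» p. 9), (3.53) `f > 0`, (3.54)
`f(r)/r < f′(r)`, (3.68)/(1.28) `f(s)/s → ln‖u‖_∞`. Text = ref-4's retype / refuter-5's scaffold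
`Premises` verbatim (TYPING-HYGIENE 13); implied fieldwise by the skeleton's own packages
(`premises_of_fprops`). [cite: Xu2024NSLinfty, (3.53)–(3.54) p.16; (3.67)–(3.70) p.19–20] -/
structure Premises (f : ℝ → ℝ) (L q j : ℝ) : Prop where
  L_pos : 0 < L
  q_pos : 0 < q
  q_lt_j : q < j
  diff : ∀ r, 2 * q ≤ r → DifferentiableAt ℝ f r
  convex : ConvexOn ℝ (Ici (2 * q)) f
  pos : ∀ s, 2 * q ≤ s → 0 < f s
  incr : ∀ r, 2 * q ≤ r → f r / r < deriv f r
  lim : Tendsto (fun s => f s / s) atTop (𝓝 L)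

/-- **(3.70), first half, as printed** (p. 19–20): «r_ε → ∞ as ε → 0⁺» — for every `f, L, q, j` with
the printed premises and every selection `rε` of largest roots of (3.69) on `ε ∈ (0,1)`,
`rε → ∞` as `ε → 0⁺`. Text = ref-4's retype / refuter-5's scaffold `RootDivergence_asPrinted`
verbatim (TYPING-HYGIENE 13); it is `Step_12` below. [cite: Xu2024NSLinfty, (3.70) p.19–20] -/
def RootDivergence_asPrinted : Prop :=
  ∀ (f : ℝ → ℝ) (L q j : ℝ), Premises f L q j →
    ∀ rε : ℝ → ℝ, (∀ ε ∈ Ioo (0 : ℝ) 1, IsLargestRoot f L j ε (rε ε)) →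
      Tendsto rε (𝓝[>] 0) atTop

/-! ## The setting of Theorem 1.1 -/

/-- The hypotheses of Theorem 1.1 with the standing assumptions of §3: `N ≥ 3`, `ν, T > 0`; `(v, p)` a
classical solution of (1.1)–(1.3) on `ℝᴺ × [0,T]` (p. 7: «we may assume that (u,p) is a classical
solution»), `v(0) = v⁰` with `|v⁰| ∈ L² ∩ L^∞` (1.4) (∇·v⁰ = 0 is `ns.divFree 0`); the qualitative
assumption (3.1) `|v| ∈ L^∞(Q_T)`; and the pressure normalised as the Newtonian potential of
`∂²_{ij}(v_iv_j)` (p. 5: «∫ p dx = 0 … Calderón–Zygmund»), typed as `p(·,t) ∈ Lˢ(ℝᴺ)` for `s > 1`.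
[cite: Xu2024NSLinfty, Thm 1.1 p.1; (3.1) p.7] -/
structure IsLocalStrongSolution (N : ℕ) (ν T : ℝ) (v₀ : Euc N → Euc N)
    (v : ℝ → Euc N → Euc N) (p : ℝ → Euc N → ℝ) : Prop where
  /-- `N ≥ 3` (p. 1). -/
  three_le : 3 ≤ N
  /-- `ν ∈ (0,∞)` (p. 1). -/
  nu_pos : 0 < ν
  /-- `T ∈ (0,∞)` (p. 1). -/
  T_pos : 0 < T
  /-- (1.1)–(1.2) classically on `ℝᴺ × [0,T]`, no force. -/
  ns : IsClassicalNSSolutionOn (Icc 0 T) ν 0 v p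
  /-- (1.3). -/
  initial : v 0 = v₀
  /-- (1.4): `|v⁰| ∈ L²(ℝᴺ)`. -/
  data_L2 : MemLp v₀ 2 volume
  /-- (1.4): `|v⁰| ∈ L^∞(ℝᴺ)`. -/
  data_Linf : MemLp v₀ ⊤ volume
  /-- (3.1): `|v| ∈ L^∞(Q_T)`. -/
  bounded : ∃ M : ℝ, ∀ t ∈ Icc (0 : ℝ) T, ∀ x, ‖v t x‖ ≤ M
  /-- Newtonian-potential normalisation of the pressure (p. 5, p. 8). -/
  pressure_Lp : ∀ t ∈ Icc (0 : ℝ) T, ∀ s : ℝ, 1 < s → MemLp (p t) (ENNReal.ofReal s) volume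

/-- «Let w be the solution to the initial value problem (1.20)–(1.21)» (p. 4): a bounded classical
solution of `∂ₜw + (v·∇)w − νΔw = 0` on `ℝᴺ × [0,T]` with `w(0) = v⁰`. [cite: Xu2024NSLinfty, (1.20)–(1.21) p.4] -/
structure IsCompanion (N : ℕ) (ν T : ℝ) (v₀ : Euc N → Euc N) (v w : ℝ → Euc N → Euc N) : Prop where
  /-- `w` jointly smooth on `[0,T] × ℝᴺ`. -/
  smooth : IsSmoothSpaceTimeOn (Icc 0 T) w
  /-- (1.20). -/
  eqn : ∀ t ∈ Icc (0 : ℝ) T, ∀ x, timeDerivWithin (Icc 0 T) w t x + convect (v t) (w t) x = ν • (Δ (w t)) x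
  /-- (1.21). -/
  initial : w 0 = v₀
  /-- the bounded solution (weak maximum principle class, p. 8). -/
  bounded : ∃ M : ℝ, ∀ t ∈ Icc (0 : ℝ) T, ∀ x, ‖w t x‖ ≤ M

/-- The conclusions of Lemma 3.1 and (3.7)–(3.9) with the constant `c₀ = c(N,ν)` (independent of `T`,
p. 7 l. 10–11), and «|u| ∈ Lʳ(Q_T) for each r ≥ 2λ_N» (p. 9): the energy-class package Step 1
delivers and later steps consume. [cite: Xu2024NSLinfty, (3.2) p.7; (3.7)–(3.9) p.8–9] -/
structure EnergyClass (N : ℕ) (c₀ T : ℝ) (v₀ : Euc N → Euc N) (v w : ℝ → Euc N → Euc N) : Prop where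
  /-- `|v| ∈ Lʳ(Q_T)`, `r ≥ 2λ_N` ((1.18) p. 4 with (3.1)). -/
  integrable_v : ∀ r, 2 * lam N ≤ r →
    IntegrableOn (fun z : ℝ × Euc N => ‖v z.1 z.2‖ ^ r) (Icc (0 : ℝ) T ×ˢ univ) volume
  /-- `|w| ∈ Lʳ(Q_T)`, `r ≥ 2λ_N` ((3.7)–(3.8)). -/
  integrable_w : ∀ r, 2 * lam N ≤ r →
    IntegrableOn (fun z : ℝ × Euc N => ‖w z.1 z.2‖ ^ r) (Icc (0 : ℝ) T ×ˢ univ) volume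
  /-- «|u| ∈ Lʳ(Q_T) for each r ≥ 2λ_N» (p. 9). -/
  integrable_u : ∀ r, 2 * lam N ≤ r →
    IntegrableOn (fun z : ℝ × Euc N => ‖vsub v w z.1 z.2‖ ^ r) (Icc (0 : ℝ) T ×ˢ univ) volume
  /-- (3.2): `‖v‖_{2λ_N,Q_T} ≤ c(N,ν)‖v⁰‖₂`. -/
  energy_v : qInt T v (2 * lam N) ^ (1 / (2 * lam N)) ≤ c₀ * dataL2 v₀
  /-- (3.7): `‖w_i‖_∞ ≤ ‖v⁰_i‖_∞`, in the form `|w| ≤ √N ‖v⁰‖_∞` used on p. 9, p. 16. -/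
  max_w : ∀ t ∈ Icc (0 : ℝ) T, ∀ x, ‖w t x‖ ≤ Real.sqrt N * dataLinf v₀
  /-- (3.8): `‖w‖_{2λ_N,Q_T} ≤ c(N,ν)‖v⁰‖₂`. -/
  energy_w : qInt T w (2 * lam N) ^ (1 / (2 * lam N)) ≤ c₀ * dataL2 v₀
  /-- (3.9), first estimate: `‖u‖_{2λ_N,Q_T} ≤ c(N,ν)‖v⁰‖₂`. -/
  energy_u : qInt T (vsub v w) (2 * lam N) ^ (1 / (2 * lam N)) ≤ c₀ * dataL2 v₀
  /-- (3.9), second estimate: `‖u‖_{∞,Q_T} ≤ ‖v‖_{∞,Q_T} + √N‖v⁰‖_∞`. -/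
  sup_u : supQ T (vsub v w) ≤ supQ T v + Real.sqrt N * dataLinf v₀

/-- Lemma 3.2 at the exponent `q` with constant `cz = c(q,N)`, per time slice, in `ℝ≥0∞`
(no junk values): `‖p(·,t)‖_q ≤ c ‖v(·,t)‖²_{2q}`. [cite: Xu2024NSLinfty, (3.6) p.8] -/
def PressureCZ {N : ℕ} (q cz T : ℝ) (v : ℝ → Euc N → Euc N) (p : ℝ → Euc N → ℝ) : Prop :=
  ∀ t ∈ Icc (0 : ℝ) T,
    eLpNorm (p t) (ENNReal.ofReal q) volume ≤
      ENNReal.ofReal cz * eLpNorm (v t) (ENNReal.ofReal (2 * q)) volume ^ 2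

/-! ## The `f`-level data (p. 5: «We solve the third case via suitable applications of various
properties of f(r)») -/

/-- The parameter regime fixed BEFORE the solution («In summary, the order in which we pick our
parameters is as follows: We first choose q as in (3.51), which implies (3.29). Take any η > 0. Then
select j so that (3.64) and (3.74) are both satisfied», p. 21), together with the elementary
consequences the proof uses: (3.31) `α > 0`, (3.50) `m_q > N+2`, (3.52) `2q > m_q`, (3.60) `j > m_q`,
`j > q` (p. 19 l. 1–3), (3.63) positivity of the bracket for `r ≥ 2j`, positivity of the final exponent
(3.74) and of the constants `c(N,q)`, `c(N,q,j)`. [cite: Xu2024NSLinfty, (3.51)–(3.52) p.16; (3.62)–(3.64) p.18; (3.74) p.21] -/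
structure ParamFacts (N : ℕ) (q η j : ℝ) : Prop where
  /-- `N ≥ 3`. -/
  three_le : 3 ≤ N
  /-- (3.29): `q > N + 2`. -/
  q_gt : (N : ℝ) + 2 < q
  /-- (3.52): `2q − m_q > 0`. -/
  mq_lt : mq N q < 2 * q
  /-- `η > 0` (p. 19). -/
  eta_pos : 0 < η
  /-- (3.64). -/
  j_gt : q + (mq N q - lam N + Real.sqrt ((2 * q - lam N) ^ 2 + mq N q * (mq N q - 2 * lam N))) / 2 < j
  /-- (3.74). -/
  j_gt' : (mq N q - 2 * lam N) * q / lam N + 2 * lam N + η / (2 * lam N) < j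
  /-- `λ_N > 0`. -/
  lam_pos : 0 < lam N
  /-- `2λ_N < N + 2` (`N ≥ 3`). -/
  two_lam_lt : 2 * lam N < (N : ℝ) + 2
  /-- (3.31): `α > 0`. -/
  alpha_pos : 0 < alpha N q
  /-- (3.50): `m_q > N + 2`. -/
  mq_gt : (N : ℝ) + 2 < mq N q
  /-- (3.60), via (3.64) (p. 18 l.−3). -/
  mq_lt_j : mq N q < j
  /-- `j > q` (from (3.64)). -/
  q_lt_j : q < j
  /-- (3.63): the bracket is positive for `r ≥ 2j`. -/
  bracket_pos : ∀ r, 2 * j ≤ r → 0 < bracket N q j r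
  /-- the exponent of `‖u‖_∞` on p. 21 is positive ((3.74)). -/
  theta_pos : 0 < theta N q j η
  /-- `c(N,q) > 0`. -/
  cq_pos : 0 < cq N q
  /-- `c(N,q,j') > 0` for `j' > 0`. -/
  cqj_pos : ∀ j', 0 < j' → 0 < cqj N q j'

/-- The printed properties of `f` and `L = ln‖u‖_∞` that pp. 15–21 invoke: (3.11) convexity, «We may
assume that f(r) is a smooth function» (p. 9), (3.13) `f′ ≤ ln‖u‖_∞`, (3.14) the chord inequality,
(1.28) `f(r)/r → ln‖u‖_∞`, and the endpoint interpolation (1.19) `‖u‖_b^b ≤ ‖u‖_∞^{b−a}‖u‖_a^a`.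
[cite: Xu2024NSLinfty, (3.10)–(3.14) p.9; (1.19) p.4; (1.28) p.5] -/
structure FProps (N : ℕ) (f : ℝ → ℝ) (L : ℝ) : Prop where
  /-- (3.11). -/
  convex : ConvexOn ℝ (Ici (2 * lam N)) f
  /-- «f(r) is a smooth function» (p. 9). -/
  smooth : ContDiffOn ℝ ∞ f (Ioi (2 * lam N))
  /-- (3.13). -/
  deriv_le : ∀ r, 2 * lam N < r → deriv f r ≤ L
  /-- (3.14), first inequality. -/
  slope_le_deriv : ∀ r, 2 * lam N < r → (f r - f (2 * lam N)) / (r - 2 * lam N) ≤ deriv f r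
  /-- (1.28)/(3.14): `f(r)/r → ln‖u‖_∞`. -/
  tendsto_div : Tendsto (fun s => f s / s) atTop (𝓝 L)
  /-- (1.19) in logarithms (`‖u‖_b^b ≤ ‖u‖_∞^{b−a} ‖u‖_a^a`, used at `(a,b) = (2λ_N, 2q)` p. 15 and
  `(2λ_N, r_ε)` p. 20). -/
  interp : ∀ a b, 2 * lam N ≤ a → a < b → f b ≤ f a + (b - a) * L

/-- (3.44) p. 14, IN LOGARITHMS (`‖u‖_s = exp(f(s)/s)`, `‖u‖_∞ = e^L`), for all `j > 0`,
`r > max(2λ_N, 2j)` ((3.15), (3.35)), `ℓ > r` ((3.32)), with `c₁ = K(j)^{1/(r−2j)}` (3.41),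
`s₁ = c(N,q,j)/(r−2j)` (3.42), `β₁`, `α₁` of (3.39):
`‖u‖_∞ ≤ 8√N c₁ ‖u‖_{2λ_N}^{s₁} ‖u‖_ℓ^{−β₁} ‖u‖_r^{(r−j)/(r−2j)+β₁} ‖u‖_{2q}^{4/((r−2j)α) − α₁}`.
[cite: Xu2024NSLinfty, (3.44) p.14] -/
def Ineq344 (N : ℕ) (q : ℝ) (K : ℝ → ℝ) (f : ℝ → ℝ) (L : ℝ) : Prop :=
  ∀ j r ℓ : ℝ, 0 < j → 2 * lam N < r → 2 * j < r → r < ℓ →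
    L ≤ Real.log (8 * Real.sqrt N) + Real.log (K j) / (r - 2 * j)
        + cqj N q j / (r - 2 * j) * (f (2 * lam N) / (2 * lam N))
        - j * ℓ / ((r - 2 * j) * (ℓ - r)) * (f ℓ / ℓ)
        + ((r - j) / (r - 2 * j) + j * ℓ / ((r - 2 * j) * (ℓ - r))) * (f r / r)
        + (4 / ((r - 2 * j) * alpha N q) - (j * alpha N q + 2) * q / (alpha N q * (q - lam N) * (r - 2 * j)))
            * (f (2 * q) / (2 * q))

/-- Everything pp. 15–21 use about `(f, ln‖u‖_∞)`: the parameter regime, positivity of the constants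
`c(N,ν,q,j)`, the `f`-properties of p. 9, «We may assume that ‖u‖_{∞,Q_T} > 1» (p. 19), and (3.44)
for all admissible `(j, r, ℓ)`. Instantiated by the composition at `f = fLog T u`,
`L = ln (supQ T u)`, `K = Kconst N K₀ q`. [cite: Xu2024NSLinfty, pp.15–21] -/
structure FSetting (N : ℕ) (q η j : ℝ) (K : ℝ → ℝ) (f : ℝ → ℝ) (L : ℝ) : Prop where
  /-- parameters (p. 21). -/
  params : ParamFacts N q η j
  /-- `c(N,ν,q,j') > 0`. -/
  K_pos : ∀ j', 0 < j' → 0 < K j'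
  /-- (3.11)–(3.14), (1.19), (1.28). -/
  fprops : FProps N f L
  /-- `‖u‖_∞ > 1` (p. 19). -/
  L_pos : 0 < L
  /-- (3.44). -/
  ineq344 : Ineq344 N q K f L

/-- Claim 3.3, (3.46) p. 15, in logarithms: for each `r > m_q`,
`‖u‖_∞ ≤ 8√N [c(N,ν,q)]^{1/(r−m_q)} ‖u‖_{2λ_N}^{c(N,q)/(r−m_q)} ‖u‖_r^{r/(r−m_q)}` with
`c(N,ν,q) = K(m_q/2)` (proof, p. 15: `j = m_q/2`). [cite: Xu2024NSLinfty, Claim 3.3 (3.46) p.15] -/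
def Bound346 (N : ℕ) (q : ℝ) (K : ℝ → ℝ) (f : ℝ → ℝ) (L : ℝ) : Prop :=
  ∀ r, mq N q < r →
    L ≤ Real.log (8 * Real.sqrt N)
        + (Real.log (K (mq N q / 2)) + cq N q * (f (2 * lam N) / (2 * lam N)) + f r) / (r - mq N q)

/-- (3.53) p. 16: «f(s) > 0 for each s ∈ [2q, ∞)». [cite: Xu2024NSLinfty, (3.53) p.16] -/
def Pos353 (q : ℝ) (f : ℝ → ℝ) : Prop := ∀ s, 2 * q ≤ s → 0 < f s

/-- (3.54) p. 16: «(f(r)/r)′ = (r f′(r) − f(r))/r² > 0 for each r ∈ [2q, ∞)».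
[cite: Xu2024NSLinfty, (3.54) p.16] -/
def Mono354 (q : ℝ) (f : ℝ → ℝ) : Prop := ∀ r, 2 * q ≤ r → f r < r * deriv f r

/-- (3.65) p. 19, in logarithms, at the fixed `q`: «8√N ‖u‖_r^{−ηr/(2(q−λ_N)(r−2j))} ≤ 1 for each
r ∈ (2j, ∞)». [cite: Xu2024NSLinfty, (3.65) p.19] -/
def Small365 (N : ℕ) (q η j : ℝ) (f : ℝ → ℝ) : Prop :=
  ∀ r, 2 * j < r → Real.log (8 * Real.sqrt N) ≤ η * f r / (2 * (q - lam N) * (r - 2 * j))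

/-- (3.66) p. 19 (= (3.61) p. 18 with `8√N` removed by (3.65)), in logarithms, for every `r > 2j`:
`‖u‖_∞ ≤ [c(N,ν,q,j)]^{1/(r−2j)} ‖u‖_{2λ_N}^{c(N,q,j)/(r−2j)}
 exp{ f′(r)/(r−2j)·[−j + (j−m_q)(r−2q)/(2(q−λ_N))] + f(r)/(r−2j)·[1 − (j−m_q−η)/(2(q−λ_N))] }`.
[cite: Xu2024NSLinfty, (3.66) p.19] -/
def Bound366 (N : ℕ) (q η j : ℝ) (K : ℝ → ℝ) (f : ℝ → ℝ) (L : ℝ) : Prop :=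
  ∀ r, 2 * j < r →
    L ≤ Real.log (K j) / (r - 2 * j) + cqj N q j / (r - 2 * j) * (f (2 * lam N) / (2 * lam N))
        + deriv f r / (r - 2 * j) * bracket N q j r
        + f r / (r - 2 * j) * (1 - (j - mq N q - η) / (2 * (q - lam N)))

/-- (3.69)–(3.71) p. 19–20: for each `ε ∈ (0,1)` the largest solution `r_ε` of (3.69) exists and
`h′(r_ε) ≤ 0`, i.e. (3.71) `f′(r_ε) ≤ f(r_ε)((1−ε)/r_ε + ε/(r_ε−2j))`. [cite: Xu2024NSLinfty, (3.69)–(3.71) p.19–20] -/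
def Concl371 (f : ℝ → ℝ) (L j : ℝ) : Prop :=
  ∀ ε, 0 < ε → ε < 1 →
    (∃ r, IsLargestRoot f L j ε r) ∧
    ∀ r, IsLargestRoot f L j ε r → deriv f r ≤ f r * ((1 - ε) / r + ε / (r - 2 * j))

/-! ## The claimed statement -/

/-- **Theorem 1.1 as printed** (p. 1), for every `N ≥ 3`, `ν > 0`: there is `c = c(N, ν, ·, ·)` such
that for every `T > 0` and every local strong (here: classical, bounded — (3.1), p. 7) solution with
datum `|v⁰| ∈ L² ∩ L^∞`, `∇·v⁰ = 0`: `‖v‖_{∞,Q_T} ≤ c(N, ν, ‖v⁰‖₂, ‖v⁰‖_∞)` («the upper bound in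
(1.5) does not depend on T», p. 2). [cite: Xu2024NSLinfty, Thm 1.1 (1.5) p.1] -/
def ClaimedTheorem : Prop :=
  ∀ (N : ℕ) (ν : ℝ), 3 ≤ N → 0 < ν → ∃ c : ℝ → ℝ → ℝ,
    ∀ (T : ℝ) (v₀ : Euc N → Euc N) (v : ℝ → Euc N → Euc N) (p : ℝ → Euc N → ℝ),
      IsLocalStrongSolution N ν T v₀ v p →
        ∀ t ∈ Icc (0 : ℝ) T, ∀ x, ‖v t x‖ ≤ c (dataL2 v₀) (dataLinf v₀)

/-! ## The steps (nothing asserted) -/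

/-- **Step 1** — Lemma 3.1 (3.2) p. 7, (3.7)–(3.9) p. 8–9, «|u| ∈ Lʳ(Q_T) for each r ≥ 2λ_N» p. 9:
there is `c(N,ν)` such that for every solution in the setting the companion `w` of (1.20)–(1.21)
exists and every such `w` satisfies the energy-class package. [cite: Xu2024NSLinfty, Lemma 3.1 p.7; (3.7)–(3.9) p.8–9] -/
def Step_1 : Prop :=
  ∀ (N : ℕ) (ν : ℝ), 3 ≤ N → 0 < ν → ∃ c₀ : ℝ, 0 < c₀ ∧
    ∀ (T : ℝ) (v₀ : Euc N → Euc N) (v : ℝ → Euc N → Euc N) (p : ℝ → Euc N → ℝ),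
      IsLocalStrongSolution N ν T v₀ v p →
        (∃ w, IsCompanion N ν T v₀ v w) ∧ ∀ w, IsCompanion N ν T v₀ v w → EnergyClass N c₀ T v₀ v w

/-- **Step 2** — Lemma 3.2 (3.6) p. 8: «For each s > 1 there is a positive number c = c(s,N) with
‖p‖_{s,ℝᴺ} ≤ c(s,N)‖v‖²_{2s,ℝᴺ}» (Calderón–Zygmund, Newtonian-potential representation).
[cite: Xu2024NSLinfty, Lemma 3.2 (3.6) p.8] -/
def Step_2 : Prop :=
  ∀ (N : ℕ) (s : ℝ), 3 ≤ N → 1 < s → ∃ c : ℝ, 0 < c ∧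
    ∀ (ν T : ℝ) (v₀ : Euc N → Euc N) (v : ℝ → Euc N → Euc N) (p : ℝ → Euc N → ℝ),
      IsLocalStrongSolution N ν T v₀ v p → PressureCZ s c T v p

/-- **Step 3** — (3.10)–(3.14) p. 9 (with (1.19) p. 4, (1.27)–(1.28) p. 5): for a solution in the
setting with `‖u‖_∞ > 1`, the function `f(r) = ln ∫_{Q_T}|u|ʳ` and `L = ln‖u‖_{∞,Q_T}` have the
printed properties `FProps`. [cite: Xu2024NSLinfty, (3.10)–(3.14) p.9] -/
def Step_3 : Prop :=
  ∀ (N : ℕ) (ν T c₀ : ℝ) (v₀ : Euc N → Euc N) (v w : ℝ → Euc N → Euc N) (p : ℝ → Euc N → ℝ),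
    IsLocalStrongSolution N ν T v₀ v p → IsCompanion N ν T v₀ v w → EnergyClass N c₀ T v₀ v w →
      1 < supQ T (vsub v w) →
        FProps N (fLog T (vsub v w)) (Real.log (supQ T (vsub v w)))

/-- **Step 4** — (1.7)/(1.16) p. 2–4: «the classical regularity theory for linear parabolic equations
asserts that for each q > N+2 there is a constant c = c(N,ν,q) such that (1.7)», and with Lemma 3.2
(1.16) `‖v‖_{∞,Q_T} ≤ 2√N‖v⁰‖_∞ + c(N,ν,q)‖v⁰‖₂ + c(N,q)‖v‖²_{2q,Q_T}`. [cite: Xu2024NSLinfty, (1.16) p.4] -/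
def Step_4 : Prop :=
  ∀ (N : ℕ) (ν q cz : ℝ), 3 ≤ N → 0 < ν → (N : ℝ) + 2 < q → 0 < cz → ∃ c c' : ℝ, 0 ≤ c ∧ 0 ≤ c' ∧
    ∀ (T c₀ : ℝ) (v₀ : Euc N → Euc N) (v w : ℝ → Euc N → Euc N) (p : ℝ → Euc N → ℝ),
      IsLocalStrongSolution N ν T v₀ v p → IsCompanion N ν T v₀ v w → EnergyClass N c₀ T v₀ v w →
        PressureCZ q cz T v p →
          supQ T v ≤ 2 * Real.sqrt N * dataLinf v₀ + c * dataL2 v₀ + c' * qInt T v (2 * q) ^ (1 / q)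

/-- **Step 5** — Proof of Theorem 1.1, (3.15)–(3.44) pp. 9–14 (De Giorgi for `φ = u/‖u‖_r` with the
level condition (3.33), the choices of `L₁`, `L₂`, `k` (3.36)–(3.38), and (3.40)–(3.42)): there is
`c(N,ν,q)` such that, under (3.43) `‖w‖_{2q,Q_T} ≤ ‖u‖_{2q,Q_T}`, the bound (3.44) holds for all
`j > 0`, `r > max(2λ_N,2j)`, `ℓ > r` (typed in logarithms, `Ineq344`, under «‖u‖_∞ > 1» of p. 19 so
that every norm is positive). Typist's PREDICTED locator (CARD §4). [cite: Xu2024NSLinfty, (3.15)–(3.44) pp.9–14] -/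
def Step_5 : Prop :=
  ∀ (N : ℕ) (ν q cz : ℝ), 3 ≤ N → 0 < ν → (N : ℝ) + 2 < q → 0 < cz → ∃ K₀ : ℝ, 0 < K₀ ∧
    ∀ (T c₀ : ℝ) (v₀ : Euc N → Euc N) (v w : ℝ → Euc N → Euc N) (p : ℝ → Euc N → ℝ),
      IsLocalStrongSolution N ν T v₀ v p → IsCompanion N ν T v₀ v w → EnergyClass N c₀ T v₀ v w →
        PressureCZ q cz T v p → 1 < supQ T (vsub v w) →
          qInt T w (2 * q) ≤ qInt T (vsub v w) (2 * q) →
            Ineq344 N q (Kconst N K₀ q) (fLog T (vsub v w)) (Real.log (supQ T (vsub v w)))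

/-- **Step 6** — the other branch of (3.43), p. 14–15: «if … ‖w‖_{2q,Q_T} ≥ ‖u‖_{2q,Q_T} … then we can
conclude from (1.19), (3.7), and (3.8) that ‖v‖_{2q,Q_T} ≤ 2‖w‖_{2q,Q_T} ≤ c(N,ν)‖v⁰‖_∞^{(q−λ_N)/q}
‖v⁰‖₂^{λ_N/q}. Combine this with (1.16) … Thus, (1.5) follows.» [cite: Xu2024NSLinfty, (3.43) p.14–15] -/
def Step_6 : Prop :=
  ∀ (N : ℕ) (ν q T c₀ c c' : ℝ) (v₀ : Euc N → Euc N) (v w : ℝ → Euc N → Euc N) (p : ℝ → Euc N → ℝ),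
    (N : ℝ) + 2 < q → IsLocalStrongSolution N ν T v₀ v p → IsCompanion N ν T v₀ v w →
      EnergyClass N c₀ T v₀ v w →
        supQ T v ≤ 2 * Real.sqrt N * dataLinf v₀ + c * dataL2 v₀ + c' * qInt T v (2 * q) ^ (1 / q) →
          0 ≤ c' → qInt T (vsub v w) (2 * q) ≤ qInt T w (2 * q) →
            ∀ t ∈ Icc (0 : ℝ) T, ∀ x, ‖v t x‖ ≤
              2 * Real.sqrt N * dataLinf v₀ + c * dataL2 v₀
                + c' * (4 * (Real.sqrt N * dataLinf v₀) ^ (2 * (q - lam N) / q)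
                        * (c₀ * dataL2 v₀) ^ (2 * lam N / q))

/-- **Step 7** — glue «this implies (1.5)» (p. 16, p. 19, p. 21) through (3.9) p. 9: if `‖u‖_∞ ≤ 1` or
`ln‖u‖_∞ ≤ P + Q·max(ln‖u‖_{2λ_N}, 0)` with `Q ≥ 0`, then
`|v| ≤ exp(P + Q·max(ln(c₀‖v⁰‖₂), 0)) + 1 + √N‖v⁰‖_∞` on `Q_T` (implicit arithmetic step between the
`u`-bounds of pp. 16–21 and (1.5)). [cite: Xu2024NSLinfty, (3.9) p.9 and p.21 l.47–54] -/
def Step_7 : Prop :=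
  ∀ (N : ℕ) (ν T c₀ P Q : ℝ) (v₀ : Euc N → Euc N) (v w : ℝ → Euc N → Euc N) (p : ℝ → Euc N → ℝ),
    IsLocalStrongSolution N ν T v₀ v p → IsCompanion N ν T v₀ v w → EnergyClass N c₀ T v₀ v w →
      0 ≤ Q →
        (supQ T (vsub v w) ≤ 1 ∨
          Real.log (supQ T (vsub v w)) ≤
            P + Q * max (fLog T (vsub v w) (2 * lam N) / (2 * lam N)) 0) →
          ∀ t ∈ Icc (0 : ℝ) T, ∀ x,
            ‖v t x‖ ≤ Real.exp (P + Q * max (Real.log (c₀ * dataL2 v₀)) 0) + 1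
                        + Real.sqrt N * dataLinf v₀

/-- **Step 8** — Claim 3.3, (3.45)–(3.48) p. 15: from (3.44) («take ℓ → ∞», (1.19), `j = m_q/2`)
the bound (3.46) for each `r > m_q`. [cite: Xu2024NSLinfty, Claim 3.3 p.15] -/
def Step_8 : Prop :=
  ∀ (N : ℕ) (q η j : ℝ) (K : ℝ → ℝ) (f : ℝ → ℝ) (L : ℝ),
    FSetting N q η j K f L → Bound346 N q K f L

/-- **Step 9** — the other branches of the three reductions: ¬(3.53) ⇒ (1.5) (p. 16 l. 10–25),
¬(3.54) ⇒ (1.5) (p. 16 l.−8 – p. 17 l. 6, via (3.14) and (3.46)), ¬(3.65) ⇒ (1.5) (p. 19 l. 8–16), each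
as an explicit bound `ln‖u‖_∞ ≤ P + Q·max(ln‖u‖_{2λ_N}, 0)` with `P, Q` depending on `N, q, j, η` and
`c(N,ν,q)` only (uniformly in the unknown `s`, `r` of the negated hypothesis, using (3.52)).
[cite: Xu2024NSLinfty, (3.53)–(3.54) p.16–17; (3.65) p.19] -/
def Step_9 : Prop :=
  ∀ (N : ℕ) (q η j : ℝ) (K : ℝ → ℝ) (f : ℝ → ℝ) (L : ℝ),
    FSetting N q η j K f L → Bound346 N q K f L →
      (¬ Pos353 q f →
        L ≤ Real.log (8 * Real.sqrt N) + max (Real.log (K (mq N q / 2))) 0 / (2 * q - mq N q)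
              + cq N q / (2 * q - mq N q) * max (f (2 * lam N) / (2 * lam N)) 0) ∧
      (¬ Mono354 q f →
        L ≤ Real.log (8 * Real.sqrt N) + max (Real.log (K (mq N q / 2))) 0 / (2 * q - mq N q)
              + (cq N q + 2 * q) / (2 * q - mq N q) * max (f (2 * lam N) / (2 * lam N)) 0) ∧
      (¬ Small365 N q η j f →
        L ≤ Real.log (8 * Real.sqrt N) * (1 + 2 * (q - lam N) / η)
              + max (Real.log (K (mq N q / 2))) 0 / (2 * q - mq N q)
              + cq N q / (2 * q - mq N q) * max (f (2 * lam N) / (2 * lam N)) 0)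

/-- **Step 10** — (3.57)–(3.61) p. 17–18 and (3.66) p. 19: from (3.44), the interpolation (3.59)
(`r > 2q`, (3.58)), `j > m_q` (3.60), the limit `ℓ → r⁺` producing `f′(r)` (3.61), and (3.65): the
bound (3.66) for every `r > 2j`. [cite: Xu2024NSLinfty, (3.57)–(3.61) p.17–18; (3.66) p.19] -/
def Step_10 : Prop :=
  ∀ (N : ℕ) (q η j : ℝ) (K : ℝ → ℝ) (f : ℝ → ℝ) (L : ℝ),
    FSetting N q η j K f L → Small365 N q η j f → Bound366 N q η j K f L

/-- **Step 11** — (3.67)–(3.69) p. 19 and the inequality half of (3.70) with its proof, p. 19–20: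
under (3.53) (so `h(s) → +∞` as `s → 2j⁺`, (3.67)) and (1.28) (so `h(s) → ln‖u‖_∞`, (3.68)), with
`‖u‖_∞ > 1`, for each `ε ∈ (0,1)` the largest root `r_ε` of (3.69) exists and satisfies (3.71).
Hypotheses = exactly what the passage invokes: the parameter regime (`2j > 2q > 2λ_N`), the
`f`-properties of p. 9, `ln‖u‖_∞ > 0`, (3.53). [cite: Xu2024NSLinfty, (3.67)–(3.71) p.19–20] -/
def Step_11 : Prop :=
  ∀ (N : ℕ) (q η j : ℝ) (f : ℝ → ℝ) (L : ℝ),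
    ParamFacts N q η j → FProps N f L → 0 < L → Pos353 q f → Concl371 f L j

/-- **Step 12** — THE DIVERGENCE HALF OF (3.70), p. 19–20: «r_ε → ∞ as ε → 0⁺» (printed proof p. 20:
`r₀ = liminf r_ε`; «This combined with (3.67) implies that r₀ > 2j»; «If r₀ is finite, we can take
ε → 0⁺ in [(3.71)] to derive f′(r₀) ≤ f(r₀)/r₀. But this contradicts (3.54). Thus … r₀ = ∞»), under
exactly the hypotheses the passage invokes (`Premises`, RETYPE.md F3) and for any selection of largest
roots `r_ε`, `ε ∈ (0,1)` — the verbatim scaffold statement `RootDivergence_asPrinted` (TYPING-HYGIENE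
13), instantiated in `claim_of_steps` at `f = ln∫|u|ʳ`, `L = ln‖u‖_∞` through `premises_of_fprops` and
the roots delivered by Step 11. Referee's pre-read candidate first failing step (RETYPE.md §0).
[cite: Xu2024NSLinfty, (3.70) p.19–20] -/
def Step_12 : Prop := RootDivergence_asPrinted

/-- **Step 13** — (3.72)–(3.73) p. 20 and p. 21 up to «Obviously, this implies (1.5)»: insert (3.71)
into (3.66) at `r = r_ε` (the largest roots `rε ε`, `ε ∈ (0,1)`) using (3.63), `β_ε → 1`,
interpolate with (1.19), «Pass to the limit in (3.73)» using `r_ε → ∞`, require (3.74); conclusion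
`‖u‖_∞ ≤ c(N,ν,q,j,η)‖u‖_{2λ_N}^{c(N,q,j,η)}` typed as
`ln‖u‖_∞ ≤ ln K(j)/θ + ((c(N,q,j)+2λ_N)/θ)·max(ln‖u‖_{2λ_N}, 0)`, `θ` the exponent of p. 21.
[cite: Xu2024NSLinfty, (3.72)–(3.74) p.20–21] -/
def Step_13 : Prop :=
  ∀ (N : ℕ) (q η j : ℝ) (K : ℝ → ℝ) (f : ℝ → ℝ) (L : ℝ) (rε : ℝ → ℝ),
    FSetting N q η j K f L → Bound366 N q η j K f L → Concl371 f L j →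
      (∀ ε ∈ Ioo (0 : ℝ) 1, IsLargestRoot f L j ε (rε ε)) → Tendsto rε (𝓝[>] 0) atTop →
        L ≤ Real.log (K j) / theta N q j η
              + (cqj N q j + 2 * lam N) / theta N q j η * max (f (2 * lam N) / (2 * lam N)) 0

/-- **Step 14** — parameters exist: for `N ≥ 3` and `η > 0` there are `q` with (3.29), (3.51)–(3.52)
(via (3.49)–(3.50), p. 15–16) and `j` with (3.64) and (3.74), and the listed consequences hold
(«In summary, the order in which we pick our parameters …», p. 21). [cite: Xu2024NSLinfty, p.21 l.55–57; (3.49)–(3.52) p.15–16] -/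
def Step_14 : Prop :=
  ∀ N : ℕ, 3 ≤ N → ∀ η : ℝ, 0 < η → ∃ q j : ℝ, ParamFacts N q η j

/-- **Step 15** — the continuation step, p. 2 l. 10–13 («A result of [18] asserts that a local
(in-time) strong solution … does exist under (1.4) … it can be extended for all time»), p. 7 l. 22–26,
p. 21 l. 58–59, typed for the Clay instance `N = 3`, Clay data (4): either the datum has a Clay-sense
global smooth solution, or there are `T* > 0` and a solution which is in the setting of Theorem 1.1 on
every `[0,T]`, `T < T*`, and whose modulus is unbounded on `ℝ³ × (0,T*)` (Leray's local theory and
blow-up alternative, as reviewed in [18]: local strong solution for `u₀ ∈ H ∩ L^∞`, and «‖u(t)‖_∞ blows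
up as t → T₀⁻» if the maximal time `T₀` is finite). [cite: Xu2024NSLinfty, p.2 l.10–13; p.7 l.22–26]
[18] = [cite: OzanskiPooley2018, §3.2 Thm «Local existence of strong solutions» and §3.3 «Characterisation of singularities» (arXiv 1708.09787)] -/
def Step_15 : Prop :=
  ∀ ν : ℝ, 0 < ν → ∀ u₀ : Euc 3 → Euc 3, ContDiff ℝ ∞ u₀ → NSWave0.IsDivFree u₀ →
    HasRapidSpatialDecay u₀ →
      ClayVariants.clayR3.Solvable ν 0 u₀ ∨
        ∃ Ts : ℝ, 0 < Ts ∧ ∃ (v : ℝ → Euc 3 → Euc 3) (p : ℝ → Euc 3 → ℝ),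
          (∀ T, 0 < T → T < Ts → IsLocalStrongSolution 3 ν T u₀ v p) ∧
          ∀ M : ℝ, ∃ t ∈ Ioo (0 : ℝ) Ts, ∃ x, M < ‖v t x‖

/-- **(3.70), second half / (3.71), as retyped by the referee** (p. 20 l. 1–8): at every largest root,
`h′(r_ε) ≤ 0`, i.e. `f′(r_ε) ≤ f(r_ε)((1−ε)/r_ε + ε/(r_ε − 2j))`, over the printed premises. Text =
ref-4's `RootDerivative_asPrinted` verbatim (TYPING-HYGIENE 13). TRUE at a largest root (IVT on
`(r_ε, ∞)`); recorded for the verdict table — the on-path form consumed by `claim_of_steps` is the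
derivative clause of `Concl371` (Step 11). [cite: Xu2024NSLinfty, (3.70)–(3.71) p.19–20] -/
def RootDerivative_asPrinted : Prop :=
  ∀ (f : ℝ → ℝ) (L q j : ℝ), Premises f L q j →
    ∀ ε ∈ Ioo (0 : ℝ) 1, ∀ r, IsLargestRoot f L j ε r →
      deriv f r ≤ f r * ((1 - ε) / r + ε / (r - 2 * j))

/-- **p. 2 l. 10, as printed, every `N ≥ 3`:** «A result of [18] asserts that a local (in-time) strong
solution to (1.1)-(1.3) does exist under (1.4)» — typed for the smooth sub-case of (1.4) used by the
skeleton's solution notion (a datum smooth, divergence free, in `L² ∩ L^∞`): some `T > 0` and a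
solution in the setting of Theorem 1.1 on `[0,T]`. Recorded, not on the path of `claim_of_steps`
(whose Clay instance is `Step_15`); note [18] (Ożański–Pooley) treats `N = 3` only.
[cite: Xu2024NSLinfty, p.2 l.10] [18] = [cite: OzanskiPooley2018, §3.2 Thm «Local existence of strong solutions»] -/
def LocalExistence_asCited : Prop :=
  ∀ (N : ℕ) (ν : ℝ), 3 ≤ N → 0 < ν → ∀ v₀ : Euc N → Euc N, ContDiff ℝ ∞ v₀ →
    NSWave0.IsDivFree v₀ → MemLp v₀ 2 volume → MemLp v₀ ⊤ volume →
      ∃ T : ℝ, ∃ (v : ℝ → Euc N → Euc N) (p : ℝ → Euc N → ℝ), IsLocalStrongSolution N ν T v₀ v p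

/-- The solution-level reading of (3.70)'s divergence half (RETYPE.md R#c): Step 12 with `f`, `L`
the actual `f(r) = ln∫_{Q_T}|u|ʳ`, `ln‖u‖_{∞,Q_T}` of a solution in the setting. Recorded for the
verdict table; it follows from Steps 3 and 12 (`step_12_NS_of_steps`). [cite: Xu2024NSLinfty, (3.70) p.19–20] -/
def Step_12_NS : Prop :=
  ∀ (N : ℕ) (ν q η j T c₀ : ℝ) (v₀ : Euc N → Euc N) (v w : ℝ → Euc N → Euc N) (p : ℝ → Euc N → ℝ)
    (rε : ℝ → ℝ), ParamFacts N q η j →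
      IsLocalStrongSolution N ν T v₀ v p → IsCompanion N ν T v₀ v w → EnergyClass N c₀ T v₀ v w →
        1 < supQ T (vsub v w) →
          Pos353 q (fLog T (vsub v w)) → Mono354 q (fLog T (vsub v w)) →
            (∀ ε ∈ Ioo (0 : ℝ) 1,
                IsLargestRoot (fLog T (vsub v w)) (Real.log (supQ T (vsub v w))) j ε (rε ε)) →
              Tendsto rε (𝓝[>] 0) atTop

/-! ## Small lemmas (bookkeeping) -/

/-- `c(N,ν,q,j) > 0` for `j`, `K₀ > 0` (positivity of the constant (3.41)). [cite: Xu2024NSLinfty, (3.41) p.14] -/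
theorem Kconst_pos {N : ℕ} {K₀ q j : ℝ} (hN : 3 ≤ N) (hK₀ : 0 < K₀) : 0 < Kconst N K₀ q j := by
  have hN' : (0 : ℝ) < Real.sqrt N := Real.sqrt_pos.mpr (by exact_mod_cast (by omega : 0 < N))
  unfold Kconst
  have h1 : (0 : ℝ) < 2 ^ (4 / alpha N q) := Real.rpow_pos_of_pos (by norm_num) _
  have h2 : (0 : ℝ) < (4 * Real.sqrt N) ^ j := Real.rpow_pos_of_pos (by positivity) _
  have h3 : (0 : ℝ) < (8 * Real.sqrt N) ^ ((2 + j * alpha N q) / alpha N q) :=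
    Real.rpow_pos_of_pos (by positivity) _
  positivity

/-- The coefficient of the main-line bound (Step 13) is nonnegative. [cite: Xu2024NSLinfty, (3.74) p.21] -/
theorem coeff_main_nonneg {N : ℕ} {q η j : ℝ} (hP : ParamFacts N q η j) :
    0 ≤ (cqj N q j + 2 * lam N) / theta N q j η := by
  have h1 := hP.cqj_pos j (lt_trans (lt_trans (by linarith [hP.two_lam_lt, hP.lam_pos]) hP.q_gt) hP.q_lt_j)
  have h2 := hP.lam_pos
  have h3 := hP.theta_pos
  positivity

/-- The coefficients of the escape bounds (Step 9) are nonnegative ((3.52)). [cite: Xu2024NSLinfty, (3.52) p.16] -/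
theorem coeff_esc_nonneg {N : ℕ} {q η j : ℝ} (hP : ParamFacts N q η j) :
    0 ≤ cq N q / (2 * q - mq N q) ∧ 0 ≤ (cq N q + 2 * q) / (2 * q - mq N q) := by
  have h1 := hP.cq_pos
  have h2 : 0 < 2 * q - mq N q := by linarith [hP.mq_lt]
  have h3 : 0 < q := lt_trans (by positivity) hP.q_gt
  exact ⟨by positivity, by positivity⟩

/-- The printed premises of p. 19–20 (`Premises`, scaffold text) follow fieldwise from the skeleton's
parameter regime, the `f`-package of p. 9, `ln‖u‖_∞ > 0`, (3.53) and (3.54) (bookkeeping: `2q > 2λ_N`,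
`f(r)/r < f′(r) ⇔ f(r) < r f′(r)` for `r > 0`). [cite: Xu2024NSLinfty, (3.53)–(3.54) p.16; p.19] -/
theorem premises_of_fprops {N : ℕ} {q η j : ℝ} {f : ℝ → ℝ} {L : ℝ} (hP : ParamFacts N q η j)
    (hF : FProps N f L) (hL : 0 < L) (h353 : Pos353 q f) (h354 : Mono354 q f) :
    Premises f L q j := by
  have hN0 : (0 : ℝ) ≤ N := Nat.cast_nonneg N
  have hq2 : 2 * lam N < 2 * q := by linarith [hP.two_lam_lt, hP.q_gt, hP.lam_pos]
  have hq0 : 0 < q := by linarith [hP.q_gt]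
  refine ⟨hL, hq0, hP.q_lt_j, ?_, ?_, h353, ?_, hF.tendsto_div⟩
  · intro r hr
    have hr' : r ∈ Ioi (2 * lam N) := by simp only [mem_Ioi]; linarith
    exact ((hF.smooth.differentiableOn (by simp)) r hr').differentiableAt (Ioi_mem_nhds hr')
  · exact hF.convex.subset (Ici_subset_Ici.mpr hq2.le) (convex_Ici _)
  · intro r hr
    have hr0 : 0 < r := by linarith
    rw [div_lt_iff₀ hr0, mul_comm]
    exact h354 r hr

/-! ## Compositions (kernel) -/

/-- The solution-level divergence statement is Step 12 instantiated through Step 3 (pure logic).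
[cite: Xu2024NSLinfty, (3.70) p.19–20] -/
theorem step_12_NS_of_steps (h3 : Step_3) (h12 : Step_12) : Step_12_NS := by
  intro N ν q η j T c₀ v₀ v w p rε hP hS hw hE hU h353 h354 hsel
  exact h12 _ _ q j (premises_of_fprops hP (h3 N ν T c₀ v₀ v w p hS hw hE hU) (Real.log_pos hU)
    h353 h354) rε hsel

/-- **COMPOSITION.** The printed argument composes: Theorem 1.1 follows from Steps 1–14 by the
paper's case analysis (p. 19 `‖u‖_∞ ≤ 1`; (3.43) p. 14; (3.53), (3.54) p. 16; (3.65) p. 19) and modus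
ponens, the constant of (1.5) being the maximum of the six printed branch bounds (`η = 1`).
[cite: Xu2024NSLinfty, Proof of Theorem 1.1 pp.9–21] -/
theorem claim_of_steps (h1 : Step_1) (h2 : Step_2) (h3 : Step_3) (h4 : Step_4) (h5 : Step_5)
    (h6 : Step_6) (h7 : Step_7) (h8 : Step_8) (h9 : Step_9) (h10 : Step_10) (h11 : Step_11)
    (h12 : Step_12) (h13 : Step_13) (h14 : Step_14) : ClaimedTheorem := by
  intro N ν hN hν
  -- parameters and constants, all fixed before `T` and the solution (p. 21, p. 7 l. 10–11)
  obtain ⟨q, j, hP⟩ := h14 N hN 1 one_pos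
  have hq1 : (1 : ℝ) < q := lt_trans (by linarith [hP.two_lam_lt, hP.lam_pos]) hP.q_gt
  obtain ⟨c₀, hc₀, H1⟩ := h1 N ν hN hν
  obtain ⟨cz, hcz, H2⟩ := h2 N q hN hq1
  obtain ⟨c, c', hc, hc', H4⟩ := h4 N ν q cz hN hν hP.q_gt hcz
  obtain ⟨K₀, hK₀, H5⟩ := h5 N ν q cz hN hν hP.q_gt hcz
  have hKpos : ∀ j', 0 < j' → 0 < Kconst N K₀ q j' := fun j' _ => Kconst_pos hN hK₀
  obtain ⟨hQ1, hQ2⟩ := coeff_esc_nonneg hP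
  have hQ0 := coeff_main_nonneg hP
  -- the six branch bounds as functions of (‖v⁰‖₂, ‖v⁰‖_∞) = (a, b)
  refine ⟨fun a b =>
    max (2 * Real.sqrt N * b + c * a
          + c' * (4 * (Real.sqrt N * b) ^ (2 * (q - lam N) / q) * (c₀ * a) ^ (2 * lam N / q)))
    (max (Real.exp (0 + 0 * max (Real.log (c₀ * a)) 0) + 1 + Real.sqrt N * b)
    (max (Real.exp (Real.log (Kconst N K₀ q j) / theta N q j 1
            + (cqj N q j + 2 * lam N) / theta N q j 1 * max (Real.log (c₀ * a)) 0)
          + 1 + Real.sqrt N * b)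
    (max (Real.exp (Real.log (8 * Real.sqrt N)
            + max (Real.log (Kconst N K₀ q (mq N q / 2))) 0 / (2 * q - mq N q)
            + cq N q / (2 * q - mq N q) * max (Real.log (c₀ * a)) 0) + 1 + Real.sqrt N * b)
    (max (Real.exp (Real.log (8 * Real.sqrt N)
            + max (Real.log (Kconst N K₀ q (mq N q / 2))) 0 / (2 * q - mq N q)
            + (cq N q + 2 * q) / (2 * q - mq N q) * max (Real.log (c₀ * a)) 0) + 1 + Real.sqrt N * b)
    (Real.exp (Real.log (8 * Real.sqrt N) * (1 + 2 * (q - lam N) / 1)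
            + max (Real.log (Kconst N K₀ q (mq N q / 2))) 0 / (2 * q - mq N q)
            + cq N q / (2 * q - mq N q) * max (Real.log (c₀ * a)) 0) + 1 + Real.sqrt N * b))))),
    ?_⟩
  intro T v₀ v p hS t ht x
  obtain ⟨⟨w, hw⟩, H1'⟩ := H1 T v₀ v p hS
  have hE : EnergyClass N c₀ T v₀ v w := H1' w hw
  -- «We may assume that ‖u‖_{∞,Q_T} > 1. Were this not true, we would have nothing more to prove.» (p. 19)
  rcases le_or_gt (supQ T (vsub v w)) 1 with hU | hU
  · have hb := h7 N ν T c₀ 0 0 v₀ v w p hS hw hE le_rfl (Or.inl hU) t ht x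
    exact le_trans hb (le_max_of_le_right (le_max_left _ _))
  -- the dichotomy (3.43), p. 14
  rcases le_total (qInt T w (2 * q)) (qInt T (vsub v w) (2 * q)) with h43 | h43
  · -- main line: (3.44) holds
    have hF := h3 N ν T c₀ v₀ v w p hS hw hE hU
    have h344 := H5 T c₀ v₀ v w p hS hw hE (H2 ν T v₀ v p hS) hU h43
    have hFS : FSetting N q 1 j (Kconst N K₀ q) (fLog T (vsub v w)) (Real.log (supQ T (vsub v w))) :=
      ⟨hP, hKpos, hF, Real.log_pos hU, h344⟩
    have h346 := h8 _ _ _ _ _ _ _ hFS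
    obtain ⟨E353, E354, E365⟩ := h9 _ _ _ _ _ _ _ hFS h346
    by_cases h353 : Pos353 q (fLog T (vsub v w))
    · by_cases h354 : Mono354 q (fLog T (vsub v w))
      · by_cases h365 : Small365 N q 1 j (fLog T (vsub v w))
        · -- (3.66) → largest roots (3.71) → «r_ε → ∞» → limit (p. 19–21)
          have h366 := h10 _ _ _ _ _ _ _ hFS h365
          have h371 := h11 N q 1 j _ _ hP hF (Real.log_pos hU) h353
          -- the largest roots `r_ε`, `ε ∈ (0,1)` (Step 11), as a selection
          have hsel : ∀ ε ∈ Ioo (0 : ℝ) 1, IsLargestRoot (fLog T (vsub v w))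
              (Real.log (supQ T (vsub v w))) j ε
              ((fun ε : ℝ => if h : 0 < ε ∧ ε < 1 then Classical.choose (h371 ε h.1 h.2).1 else 0) ε) := by
            intro ε hε
            have h' : 0 < ε ∧ ε < 1 := hε
            simp only [dif_pos h']
            exact Classical.choose_spec (h371 ε h'.1 h'.2).1
          have hdiv := h12 _ _ q j (premises_of_fprops hP hF (Real.log_pos hU) h353 h354) _ hsel
          have hfin := h13 _ _ _ _ _ _ _ _ hFS h366 h371 hsel hdiv
          have hb := h7 N ν T c₀ _ _ v₀ v w p hS hw hE hQ0 (Or.inr hfin) t ht x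
          exact le_trans hb (le_max_of_le_right (le_max_of_le_right (le_max_left _ _)))
        · have hb := h7 N ν T c₀ _ _ v₀ v w p hS hw hE hQ1 (Or.inr (E365 h365)) t ht x
          exact le_trans hb (le_max_of_le_right (le_max_of_le_right (le_max_of_le_right
            (le_max_of_le_right (le_max_right _ _)))))
      · have hb := h7 N ν T c₀ _ _ v₀ v w p hS hw hE hQ2 (Or.inr (E354 h354)) t ht x
        exact le_trans hb (le_max_of_le_right (le_max_of_le_right (le_max_of_le_right
          (le_max_of_le_right (le_max_left _ _)))))
    · have hb := h7 N ν T c₀ _ _ v₀ v w p hS hw hE hQ1 (Or.inr (E353 h353)) t ht x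
      exact le_trans hb (le_max_of_le_right (le_max_of_le_right (le_max_of_le_right
        (le_max_left _ _))))
  · -- the other branch of (3.43), p. 15
    have hb := h6 N ν q T c₀ c c' v₀ v w p hP.q_gt hS hw hE (H4 T c₀ v₀ v w p hS hw hE (H2 ν T v₀ v p hS))
      hc' h43 t ht x
    exact le_trans hb (le_max_left _ _)

/-! ## Clay link (TYPING-HYGIENE 10 (b)) -/

/-- The exact extra input under which the claimed theorem yields Clay (A): the paper's own
continuation step `Step_15` (p. 2; axis Δ6 FORM OF THE CONCLUSION of `ClayVariants` §3 — an a-priori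
bound plus continuation instead of existence; the `RegularityAt.mono` data hypothesis is available
since Clay data lie in `L² ∩ L^∞`). A classical theorem (Leray 1934, [18]), not an open hypothesis.
[cite: Xu2024NSLinfty, p.2 l.10–13] -/
def ClayDelta : Prop := Step_15

/-- **The Millennium sentence of p. 2**: `Step_15 → ClaimedTheorem → Clay (A)` — if `T* < ∞` the
`T`-independent bound (1.5) on every `[0,T]`, `T < T*`, contradicts the blow-up alternative (pure
logic). [cite: Xu2024NSLinfty, p.2 l.10–13; p.21 l.58–59] -/
theorem clay_of_claimed_of_delta (hΔ : ClayDelta) (hC : ClaimedTheorem) :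
    ClayVariants.clayR3.Regularity := by
  intro ν hν u₀ hu₀ hdiv hdec
  rcases hΔ ν hν u₀ hu₀ hdiv hdec with hsol | ⟨Ts, _, v, p, hloc, hblow⟩
  · exact hsol
  · exfalso
    obtain ⟨c, hc⟩ := hC 3 ν le_rfl hν
    obtain ⟨t, ht, x, hx⟩ := hblow (c (dataL2 u₀) (dataLinf u₀))
    have hb := hc t u₀ v p (hloc t ht.1 ht.2) t ⟨ht.1.le, le_rfl⟩ x
    exact absurd hb (not_le.mpr hx)

/-! ## Discharges (D-0026 debt pass, ns-claims-typist-10 g4, 2026-08-27; APPEND-ONLY — no statement,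
definition, locator or class above is touched; #16's locator `Step_12` stands) -/

/-- `∫_{Q_T}|g|ʳ ≥ 0`. [folklore] -/
private theorem qInt_nonneg {N : ℕ} (T : ℝ) (g : ℝ → Euc N → Euc N) (r : ℝ) : 0 ≤ qInt T g r :=
  integral_nonneg fun _ => Real.rpow_nonneg (norm_nonneg _) _

/-- `f(r)/r ≤ max (ln (c₀‖v⁰‖₂)) 0` at `r = 2λ_N` from (3.9): `‖u‖_{2λ_N,Q_T} ≤ c₀‖v⁰‖₂`
(the `qInt = 0` corner gives `ln 0 = 0`). [cite: Xu2024NSLinfty, (3.9) p.9] -/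
theorem fLog_div_le_max {N : ℕ} {T r c : ℝ} {g : ℝ → Euc N → Euc N}
    (h : qInt T g r ^ (1 / r) ≤ c) : fLog T g r / r ≤ max (Real.log c) 0 := by
  rcases (qInt_nonneg T g r).eq_or_lt with h0 | hpos
  · simp [fLog, ← h0]
  · have hrpow_pos : 0 < qInt T g r ^ (1 / r) := Real.rpow_pos_of_pos hpos _
    have h1 : fLog T g r / r = Real.log (qInt T g r ^ (1 / r)) := by
      rw [Real.log_rpow hpos, fLog]; ring
    rw [h1]
    exact le_trans (Real.log_le_log hrpow_pos h) (le_max_left _ _)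

/-- **Step 7 holds** (the implicit glue step p. 16 / p. 19 / p. 21 through (3.9) p. 9): from
`|v| ≤ |u| + |w|`, (3.7) `|w| ≤ √N‖v⁰‖_∞`, `|u(t,x)| ≤ ‖u‖_{∞,Q_T}` (a genuine supremum: `v`, `w` are
bounded on `Q_T`), and `ln‖u‖_{2λ_N,Q_T} ≤ ln(c₀‖v⁰‖₂)` by (3.9) — pure arithmetic, as flagged in the
step table. Nothing else in the file changes; #16's locator `Step_12` is untouched.
[cite: Xu2024NSLinfty, (3.9) p.9; p.21 l.47–54] -/
theorem step7_holds : Step_7 := by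
  intro N ν T c₀ P Q v₀ v w p hS hw hE hQ hcase t ht x
  have hbdd : BddAbove ((fun z : ℝ × Euc N => ‖vsub v w z.1 z.2‖) '' (Icc (0 : ℝ) T ×ˢ univ)) := by
    obtain ⟨M, hM⟩ := hS.bounded
    obtain ⟨M', hM'⟩ := hw.bounded
    refine ⟨M + M', ?_⟩
    rintro _ ⟨z, hz, rfl⟩
    have hz1 : z.1 ∈ Icc (0 : ℝ) T := (mem_prod.mp hz).1
    exact (norm_sub_le _ _).trans (add_le_add (hM z.1 hz1 z.2) (hM' z.1 hz1 z.2))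
  have hux : ‖vsub v w t x‖ ≤ supQ T (vsub v w) :=
    le_csSup hbdd ⟨(t, x), mk_mem_prod ht (mem_univ _), rfl⟩
  have hwx : ‖w t x‖ ≤ Real.sqrt N * dataLinf v₀ := hE.max_w t ht x
  have hv : ‖v t x‖ ≤ ‖vsub v w t x‖ + ‖w t x‖ := by
    have hvx : v t x = vsub v w t x + w t x := by simp [vsub]
    rw [hvx]
    exact norm_add_le _ _
  suffices hmain : supQ T (vsub v w) ≤ Real.exp (P + Q * max (Real.log (c₀ * dataL2 v₀)) 0) + 1 by
    linarith
  have hexp_pos : 0 < Real.exp (P + Q * max (Real.log (c₀ * dataL2 v₀)) 0) := Real.exp_pos _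
  rcases le_or_gt (supQ T (vsub v w)) 1 with hU | hU
  · linarith
  have hlog : Real.log (supQ T (vsub v w))
      ≤ P + Q * max (fLog T (vsub v w) (2 * lam N) / (2 * lam N)) 0 := by
    rcases hcase with h | h
    · exact absurd h (not_le.mpr hU)
    · exact h
  have hmax : max (fLog T (vsub v w) (2 * lam N) / (2 * lam N)) 0 ≤ max (Real.log (c₀ * dataL2 v₀)) 0 :=
    max_le (fLog_div_le_max hE.energy_u) (le_max_right _ _)
  have hle : Real.log (supQ T (vsub v w)) ≤ P + Q * max (Real.log (c₀ * dataL2 v₀)) 0 :=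
    hlog.trans (by nlinarith [mul_le_mul_of_nonneg_left hmax hQ])
  have hsup : supQ T (vsub v w) ≤ Real.exp (P + Q * max (Real.log (c₀ * dataL2 v₀)) 0) := by
    rw [← Real.exp_log (lt_trans one_pos hU)]
    exact Real.exp_le_exp.mpr hle
  linarith

/-- `(a+b)^p ≤ 2^{p-1}(a^p + b^p)` for `a, b ≥ 0`, `p ≥ 1` (convexity of `x ↦ x^p`). [folklore] -/
private theorem add_rpow_le_two_rpow_mul {a b p : ℝ} (ha : 0 ≤ a) (hb : 0 ≤ b) (hp : 1 ≤ p) :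
    (a + b) ^ p ≤ 2 ^ (p - 1) * (a ^ p + b ^ p) := by
  have hcx := (convexOn_rpow hp).2 (mem_Ici.mpr ha) (mem_Ici.mpr hb)
    (by norm_num : (0:ℝ) ≤ 1/2) (by norm_num : (0:ℝ) ≤ 1/2) (by norm_num)
  simp only [smul_eq_mul] at hcx
  have h2 : (a + b) ^ p = 2 ^ p * ((1/2) * a + (1/2) * b) ^ p := by
    rw [← Real.mul_rpow (by norm_num) (by positivity)]
    congr 1
    ring
  have h3 : (2:ℝ) ^ (p - 1) * (a ^ p + b ^ p) = 2 ^ p * ((1/2) * a ^ p + (1/2) * b ^ p) := by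
    rw [Real.rpow_sub (by norm_num), Real.rpow_one]
    ring
  rw [h2, h3]
  exact mul_le_mul_of_nonneg_left hcx (by positivity)

/-- **Step 6 holds** — the other branch of (3.43), p. 14–15: if `‖u‖_{2q,Q_T} ≤ ‖w‖_{2q,Q_T}` then
`‖v‖²_{2q,Q_T} ≤ 4‖w‖²_{2q,Q_T} ≤ 4(√N‖v⁰‖_∞)^{2(q−λ_N)/q}(c₀‖v⁰‖₂)^{2λ_N/q}` by `|v|^{2q} ≤
2^{2q−1}(|u|^{2q} + |w|^{2q})`, the interpolation (1.19) `|w|^{2q} ≤ (√N‖v⁰‖_∞)^{2q−2λ_N}|w|^{2λ_N}`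
((3.7)) and (3.8); inserted in (1.16) this is the printed bound, and `|v(t,x)| ≤ ‖v‖_{∞,Q_T}` (a genuine
supremum under (3.1)). True arithmetic, as flagged in the step table; #16's locator `Step_12` is
untouched. [cite: Xu2024NSLinfty, (3.43) p.14–15; (1.19) p.4; (3.7)–(3.8) p.8] -/
theorem step6_holds : Step_6 := by
  intro N ν q T c₀ c c' v₀ v w p hq hS hw hE hsup hc' h43 t ht x
  have hN3 := hS.three_le
  have hNpos : (0:ℝ) < N := by exact_mod_cast (lt_of_lt_of_le (by norm_num) hN3)
  have hN3' : (3:ℝ) ≤ N := by exact_mod_cast hN3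
  have hlam : 0 < lam N := by unfold lam; positivity
  have hlam_le : lam N ≤ 5 / 3 := by
    unfold lam
    rw [div_le_iff₀ hNpos]
    linarith
  have hq_pos : 0 < q := by linarith
  have h2lam_le : 2 * lam N ≤ 2 * q := by linarith
  have hb0 : 0 ≤ dataLinf v₀ := ENNReal.toReal_nonneg
  have hB0 : 0 ≤ Real.sqrt N * dataLinf v₀ := mul_nonneg (Real.sqrt_nonneg _) hb0
  -- (i) |v(t,x)| ≤ ‖v‖_{∞,Q_T}
  have hbddv : BddAbove ((fun z : ℝ × Euc N => ‖v z.1 z.2‖) '' (Icc (0 : ℝ) T ×ˢ univ)) := by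
    obtain ⟨M, hM⟩ := hS.bounded
    refine ⟨M, ?_⟩
    rintro _ ⟨z, hz, rfl⟩
    exact hM z.1 (mem_prod.mp hz).1 z.2
  have hvx : ‖v t x‖ ≤ supQ T v := le_csSup hbddv ⟨(t, x), mk_mem_prod ht (mem_univ _), rfl⟩
  -- (ii) ‖v‖_{2q}^{2q} ≤ 2^{2q−1}(‖u‖_{2q}^{2q} + ‖w‖_{2q}^{2q}) ≤ 4^q ‖w‖_{2q}^{2q}
  have hmeas : MeasurableSet (Icc (0 : ℝ) T ×ˢ (univ : Set (Euc N))) :=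
    measurableSet_Icc.prod MeasurableSet.univ
  have hIu := hE.integrable_u (2 * q) h2lam_le
  have hIw := hE.integrable_w (2 * q) h2lam_le
  have h12q : (1:ℝ) ≤ 2 * q := by linarith
  have hv_le : qInt T v (2 * q)
      ≤ 2 ^ (2 * q - 1) * (qInt T (vsub v w) (2 * q) + qInt T w (2 * q)) := by
    have hpt : ∀ z : ℝ × Euc N, ‖v z.1 z.2‖ ^ (2 * q)
        ≤ 2 ^ (2 * q - 1) * (‖vsub v w z.1 z.2‖ ^ (2 * q) + ‖w z.1 z.2‖ ^ (2 * q)) := by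
      intro z
      have hvz : v z.1 z.2 = vsub v w z.1 z.2 + w z.1 z.2 := by simp [vsub]
      calc ‖v z.1 z.2‖ ^ (2 * q) = ‖vsub v w z.1 z.2 + w z.1 z.2‖ ^ (2 * q) := by rw [← hvz]
        _ ≤ (‖vsub v w z.1 z.2‖ + ‖w z.1 z.2‖) ^ (2 * q) :=
            Real.rpow_le_rpow (norm_nonneg _) (norm_add_le _ _) (by linarith)
        _ ≤ _ := add_rpow_le_two_rpow_mul (norm_nonneg _) (norm_nonneg _) h12q
    unfold qInt
    calc ∫ z in Icc (0:ℝ) T ×ˢ univ, ‖v z.1 z.2‖ ^ (2 * q)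
        ≤ ∫ z in Icc (0:ℝ) T ×ˢ univ,
            2 ^ (2 * q - 1) * (‖vsub v w z.1 z.2‖ ^ (2 * q) + ‖w z.1 z.2‖ ^ (2 * q)) :=
          integral_mono_of_nonneg (Eventually.of_forall fun z => Real.rpow_nonneg (norm_nonneg _) _)
            ((hIu.add hIw).const_mul _) (Eventually.of_forall hpt)
      _ = 2 ^ (2 * q - 1) * ((∫ z in Icc (0:ℝ) T ×ˢ univ, ‖vsub v w z.1 z.2‖ ^ (2 * q))
            + ∫ z in Icc (0:ℝ) T ×ˢ univ, ‖w z.1 z.2‖ ^ (2 * q)) := by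
          rw [integral_const_mul, integral_add hIu hIw]
  have hv_le' : qInt T v (2 * q) ≤ 4 ^ q * qInt T w (2 * q) := by
    have h4 : (4:ℝ) ^ q = 2 ^ (2 * q - 1) * 2 := by
      rw [show (4:ℝ) = 2 ^ (2:ℝ) by norm_num, ← Real.rpow_mul (by norm_num),
        Real.rpow_sub (by norm_num), Real.rpow_one]
      ring
    have h2pos : (0:ℝ) ≤ 2 ^ (2 * q - 1) := by positivity
    rw [h4]
    calc qInt T v (2 * q)
        ≤ 2 ^ (2 * q - 1) * (qInt T (vsub v w) (2 * q) + qInt T w (2 * q)) := hv_le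
      _ ≤ 2 ^ (2 * q - 1) * (qInt T w (2 * q) + qInt T w (2 * q)) := by gcongr
      _ = 2 ^ (2 * q - 1) * 2 * qInt T w (2 * q) := by ring
  -- (iii) interpolation (1.19) with (3.7): ‖w‖_{2q}^{2q} ≤ (√N‖v⁰‖_∞)^{2q−2λ} ‖w‖_{2λ}^{2λ}
  have hIw2 := hE.integrable_w (2 * lam N) le_rfl
  have hw_le : qInt T w (2 * q)
      ≤ (Real.sqrt N * dataLinf v₀) ^ (2 * q - 2 * lam N) * qInt T w (2 * lam N) := by
    unfold qInt
    rw [← integral_const_mul]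
    refine integral_mono_of_nonneg (Eventually.of_forall fun z => Real.rpow_nonneg (norm_nonneg _) _)
      (hIw2.const_mul _) ?_
    refine (ae_restrict_iff' hmeas).mpr (Eventually.of_forall fun z hz => ?_)
    have hz1 : z.1 ∈ Icc (0:ℝ) T := (mem_prod.mp hz).1
    have hwz : ‖w z.1 z.2‖ ≤ Real.sqrt N * dataLinf v₀ := hE.max_w z.1 hz1 z.2
    have hsplit : ‖w z.1 z.2‖ ^ (2 * q)
        = ‖w z.1 z.2‖ ^ (2 * q - 2 * lam N) * ‖w z.1 z.2‖ ^ (2 * lam N) := by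
      rw [← Real.rpow_add_of_nonneg (norm_nonneg _) (by linarith) (by linarith)]
      congr 1
      ring
    show ‖w z.1 z.2‖ ^ (2 * q) ≤ (Real.sqrt N * dataLinf v₀) ^ (2 * q - 2 * lam N) * ‖w z.1 z.2‖ ^ (2 * lam N)
    rw [hsplit]
    exact mul_le_mul_of_nonneg_right
      (Real.rpow_le_rpow (norm_nonneg _) hwz (by linarith)) (Real.rpow_nonneg (norm_nonneg _) _)
  -- (iv) (3.8): ‖w‖_{2λ}^{2λ} ≤ (c₀‖v⁰‖₂)^{2λ}
  have hX0 : 0 ≤ qInt T w (2 * lam N) := qInt_nonneg _ _ _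
  have hA0 : 0 ≤ c₀ * dataL2 v₀ := le_trans (Real.rpow_nonneg hX0 _) hE.energy_w
  have hw2 : qInt T w (2 * lam N) ≤ (c₀ * dataL2 v₀) ^ (2 * lam N) := by
    have h2l : 2 * lam N ≠ 0 := ne_of_gt (by positivity)
    calc qInt T w (2 * lam N)
        = (qInt T w (2 * lam N) ^ (1 / (2 * lam N))) ^ (2 * lam N) := by
          rw [one_div, Real.rpow_inv_rpow hX0 h2l]
      _ ≤ (c₀ * dataL2 v₀) ^ (2 * lam N) :=
          Real.rpow_le_rpow (Real.rpow_nonneg hX0 _) hE.energy_w (by positivity)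
  -- (v) combine and take the `1/q`-th power
  have hY0 : 0 ≤ (Real.sqrt N * dataLinf v₀) ^ (2 * q - 2 * lam N) * (c₀ * dataL2 v₀) ^ (2 * lam N) :=
    mul_nonneg (Real.rpow_nonneg hB0 _) (Real.rpow_nonneg hA0 _)
  have h4q : (0:ℝ) ≤ 4 ^ q := by positivity
  have hBq : 0 ≤ (Real.sqrt N * dataLinf v₀) ^ (2 * q - 2 * lam N) := Real.rpow_nonneg hB0 _
  have hqv : qInt T v (2 * q)
      ≤ 4 ^ q * ((Real.sqrt N * dataLinf v₀) ^ (2 * q - 2 * lam N) * (c₀ * dataL2 v₀) ^ (2 * lam N)) := by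
    calc qInt T v (2 * q) ≤ 4 ^ q * qInt T w (2 * q) := hv_le'
      _ ≤ 4 ^ q * ((Real.sqrt N * dataLinf v₀) ^ (2 * q - 2 * lam N) * qInt T w (2 * lam N)) := by
          gcongr
      _ ≤ 4 ^ q * ((Real.sqrt N * dataLinf v₀) ^ (2 * q - 2 * lam N) * (c₀ * dataL2 v₀) ^ (2 * lam N)) := by
          gcongr
  have hroot : qInt T v (2 * q) ^ (1 / q)
      ≤ 4 * (Real.sqrt N * dataLinf v₀) ^ (2 * (q - lam N) / q) * (c₀ * dataL2 v₀) ^ (2 * lam N / q) := by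
    have hq0 : 0 ≤ 1 / q := by positivity
    have e1 : (2 * q - 2 * lam N) * (1 / q) = 2 * (q - lam N) / q := by ring
    have e2 : (2 * lam N) * (1 / q) = 2 * lam N / q := by ring
    have e3 : q * (1 / q) = 1 := by field_simp
    calc qInt T v (2 * q) ^ (1 / q)
        ≤ (4 ^ q * ((Real.sqrt N * dataLinf v₀) ^ (2 * q - 2 * lam N)
            * (c₀ * dataL2 v₀) ^ (2 * lam N))) ^ (1 / q) :=
          Real.rpow_le_rpow (qInt_nonneg _ _ _) hqv hq0
      _ = 4 * (Real.sqrt N * dataLinf v₀) ^ (2 * (q - lam N) / q) * (c₀ * dataL2 v₀) ^ (2 * lam N / q) := by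
          rw [Real.mul_rpow h4q hY0, Real.mul_rpow hBq (Real.rpow_nonneg hA0 _),
            ← Real.rpow_mul (by norm_num : (0:ℝ) ≤ 4), ← Real.rpow_mul hB0, ← Real.rpow_mul hA0,
            e1, e2, e3, Real.rpow_one, mul_assoc]
  -- (vi) insert in (1.16)
  calc ‖v t x‖ ≤ supQ T v := hvx
    _ ≤ 2 * Real.sqrt N * dataLinf v₀ + c * dataL2 v₀ + c' * qInt T v (2 * q) ^ (1 / q) := hsup
    _ ≤ 2 * Real.sqrt N * dataLinf v₀ + c * dataL2 v₀
          + c' * (4 * (Real.sqrt N * dataLinf v₀) ^ (2 * (q - lam N) / q)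
                  * (c₀ * dataL2 v₀) ^ (2 * lam N / q)) := by
        gcongr

/-! ## Discharge of Step 11 (D-0026 debt pass, ns-claims-typist-4 g5, 2026-08-27; APPEND-ONLY —
no statement, definition, locator or class above is touched; #16's locator `Step_12` stands).
The largest-root device of (3.67)–(3.71) p. 19–20 is elementary real analysis on `(2j, ∞)`: with
`h(s) = f(s)/(s^{1−ε}(s−2j)^ε)` (`hfun`), `h → +∞` at `2j⁺` (since `f(2j) > 0`, (3.53)) and
`h → ln‖u‖_∞ < (1+ε) ln‖u‖_∞` at `∞` (by (1.28)), so the root set of (3.69) in `(2j,∞)` is nonempty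
(IVT) and compact, its supremum is the largest root `r_ε`, `h ≤ h(r_ε)` on `(r_ε, ∞)` (IVT again), and
the one-sided derivative gives `h′(r_ε) ≤ 0`, which is (3.71). -/

namespace LargestRoot

variable {f : ℝ → ℝ} {L j ε : ℝ}

/-- The denominator `s^{1−ε}(s−2j)^ε` of `h` is positive on `(2j,∞)` (`j > 0`). [folklore] -/
private theorem den_pos (hj : 0 < j) {s : ℝ} (hs : 2 * j < s) :
    0 < s ^ (1 - ε) * (s - 2 * j) ^ ε :=
  mul_pos (Real.rpow_pos_of_pos (by linarith) _) (Real.rpow_pos_of_pos (by linarith) _)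

/-- `h` is continuous on `(2j,∞)` when `f` is differentiable on `[2j,∞)` («f is a smooth function»,
p. 9; the denominator is smooth and positive there). [cite: Xu2024NSLinfty, p.19 after (3.66)] -/
theorem continuousOn_hfun (hj : 0 < j) (hdiff : ∀ s, 2 * j ≤ s → DifferentiableAt ℝ f s) :
    ContinuousOn (hfun f j ε) (Ioi (2 * j)) := by
  have hf : ContinuousOn f (Ioi (2 * j)) := fun s hs =>
    (hdiff s (le_of_lt hs)).continuousAt.continuousWithinAt
  have h1 : ContinuousOn (fun s : ℝ => s ^ (1 - ε)) (Ioi (2 * j)) := fun s hs =>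
    (Real.continuousAt_rpow_const s (1 - ε) (Or.inl (by simp only [mem_Ioi] at hs; linarith))).continuousWithinAt
  have h2 : ContinuousOn (fun s : ℝ => (s - 2 * j) ^ ε) (Ioi (2 * j)) := fun s hs => by
    have hc : ContinuousAt (fun s : ℝ => s - 2 * j) s := (continuous_sub_right (2 * j)).continuousAt
    exact (hc.rpow_const (Or.inl (by simp only [mem_Ioi] at hs; linarith))).continuousWithinAt
  refine (hf.div (h1.mul h2) fun s hs => (den_pos (ε := ε) hj hs).ne').congr fun s _ => ?_
  rfl

/-- **(3.68) p. 19**: `h(s) → ln‖u‖_∞` (`= L`) as `s → ∞`, from (1.28) `f(s)/s → L`.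
[cite: Xu2024NSLinfty, (3.68) p.19] -/
theorem tendsto_hfun_atTop (hj : 0 < j) (hlim : Tendsto (fun s => f s / s) atTop (𝓝 L)) :
    Tendsto (hfun f j ε) atTop (𝓝 L) := by
  have hq : Tendsto (fun s : ℝ => (s - 2 * j) / s) atTop (𝓝 1) := by
    have : Tendsto (fun s : ℝ => 1 - 2 * j * s⁻¹) atTop (𝓝 (1 - 2 * j * 0)) :=
      tendsto_const_nhds.sub (tendsto_const_nhds.mul tendsto_inv_atTop_zero)
    rw [mul_zero, sub_zero] at this
    refine this.congr' ?_
    filter_upwards [eventually_gt_atTop (0 : ℝ)] with s hs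
    field_simp
  have hq' : Tendsto (fun s : ℝ => (((s - 2 * j) / s) ^ ε)⁻¹) atTop (𝓝 1) := by
    have h1 := hq.rpow_const (p := ε) (Or.inl one_ne_zero)
    rw [Real.one_rpow] at h1
    simpa using h1.inv₀ one_ne_zero
  have hprod := hlim.mul hq'
  rw [mul_one] at hprod
  refine hprod.congr' ?_
  filter_upwards [eventually_gt_atTop (2 * j)] with s hs
  have hs0 : 0 < s := by linarith
  have hs2 : 0 < s - 2 * j := by linarith
  rw [hfun, Real.div_rpow hs2.le hs0.le, Real.rpow_sub hs0, Real.rpow_one]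
  have : s ^ ε ≠ 0 := (Real.rpow_pos_of_pos hs0 _).ne'
  have : (s - 2 * j) ^ ε ≠ 0 := (Real.rpow_pos_of_pos hs2 _).ne'
  field_simp

/-- **(3.67) p. 19**: `h(s) → +∞` as `s → 2j⁺`, from (3.53) (`f(2j) > 0`) and `ε > 0`.
[cite: Xu2024NSLinfty, (3.67) p.19] -/
theorem tendsto_hfun_nhdsGT (hj : 0 < j) (hε : 0 < ε)
    (hdiff : ∀ s, 2 * j ≤ s → DifferentiableAt ℝ f s) (hpos : 0 < f (2 * j)) :
    Tendsto (hfun f j ε) (𝓝[>] (2 * j)) atTop := by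
  have h2j : (0 : ℝ) < 2 * j := by linarith
  -- first factor `f(s)/s^{1-ε} → f(2j)/(2j)^{1-ε} > 0`
  have hA : Tendsto (fun s => f s / s ^ (1 - ε)) (𝓝[>] (2 * j))
      (𝓝 (f (2 * j) / (2 * j) ^ (1 - ε))) := by
    have hfc : ContinuousAt f (2 * j) := (hdiff (2 * j) le_rfl).continuousAt
    have hpc : ContinuousAt (fun s : ℝ => s ^ (1 - ε)) (2 * j) :=
      Real.continuousAt_rpow_const _ _ (Or.inl h2j.ne')
    exact ((hfc.div hpc (Real.rpow_pos_of_pos h2j _).ne').tendsto).mono_left nhdsWithin_le_nhds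
  have hApos : 0 < f (2 * j) / (2 * j) ^ (1 - ε) := div_pos hpos (Real.rpow_pos_of_pos h2j _)
  -- second factor `((s-2j)^ε)⁻¹ → +∞`
  have hB0 : Tendsto (fun s : ℝ => (s - 2 * j) ^ ε) (𝓝[>] (2 * j)) (𝓝[>] 0) := by
    refine tendsto_nhdsWithin_iff.mpr ⟨?_, ?_⟩
    · have hc : ContinuousAt (fun x : ℝ => x ^ ε) 0 := Real.continuousAt_rpow_const 0 ε (Or.inr hε.le)
      have hsub : Tendsto (fun s : ℝ => s - 2 * j) (𝓝[>] (2 * j)) (𝓝 0) := by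
        have : Tendsto (fun s : ℝ => s - 2 * j) (𝓝 (2 * j)) (𝓝 (2 * j - 2 * j)) :=
          (continuous_sub_right (2 * j)).tendsto _
        rw [sub_self] at this
        exact this.mono_left nhdsWithin_le_nhds
      have := hc.tendsto.comp hsub
      simpa [Function.comp_def, Real.zero_rpow hε.ne'] using this
    · filter_upwards [self_mem_nhdsWithin] with s hs
      exact Real.rpow_pos_of_pos (by simp only [mem_Ioi] at hs; linarith) _
  have hB : Tendsto (fun s : ℝ => ((s - 2 * j) ^ ε)⁻¹) (𝓝[>] (2 * j)) atTop :=
    tendsto_inv_nhdsGT_zero.comp hB0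
  refine (hA.pos_mul_atTop hApos hB).congr' ?_
  filter_upwards [self_mem_nhdsWithin] with s hs
  rw [hfun]
  ring

/-- From `h → L < c` at `∞`: a threshold `b₀` beyond which `h < c`. [folklore] -/
private theorem exists_forall_ge_hfun_lt (hj : 0 < j) (hL : 0 < L) (hε : 0 < ε)
    (hlim : Tendsto (fun s => f s / s) atTop (𝓝 L)) :
    ∃ b₀ : ℝ, 2 * j < b₀ ∧ ∀ s, b₀ ≤ s → hfun f j ε s < (1 + ε) * L := by
  have hc : L < (1 + ε) * L := by nlinarith
  have hev := ((tendsto_hfun_atTop (ε := ε) hj hlim).eventually (gt_mem_nhds hc)).and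
    (eventually_gt_atTop (2 * j))
  obtain ⟨b₀, hb₀⟩ := hev.exists_forall_of_atTop
  exact ⟨b₀, (hb₀ b₀ le_rfl).2, fun s hs => (hb₀ s hs).1⟩

/-- **(3.69) p. 19** («Obviously, the largest solution exists, and we denote it by r_ε»): the largest
root `r_ε` of `h(s) = (1+ε) ln‖u‖_∞` on `(2j,∞)` exists — the root set is nonempty by (3.67), (3.68)
and the intermediate value theorem, compact, and its supremum is the largest root.
[cite: Xu2024NSLinfty, (3.69) p.19] -/
theorem exists_isLargestRoot (hj : 0 < j) (hL : 0 < L) (hε : 0 < ε)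
    (hdiff : ∀ s, 2 * j ≤ s → DifferentiableAt ℝ f s) (hpos : 0 < f (2 * j))
    (hlim : Tendsto (fun s => f s / s) atTop (𝓝 L)) :
    ∃ r, IsLargestRoot f L j ε r := by
  set c := (1 + ε) * L with hc_def
  obtain ⟨b₀, hb₀j, hb₀⟩ := exists_forall_ge_hfun_lt (ε := ε) hj hL hε hlim
  -- near `2j` the function exceeds `c`
  have hnear : ∀ᶠ s in 𝓝[>] (2 * j), c < hfun f j ε s :=
    (tendsto_hfun_nhdsGT hj hε hdiff hpos).eventually (eventually_gt_atTop c)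
  obtain ⟨u, hu, hsub⟩ := mem_nhdsGT_iff_exists_Ioo_subset.mp hnear
  set a := (2 * j + u) / 2 with ha_def
  have hau : a ∈ Ioo (2 * j) u := by
    simp only [mem_Ioi] at hu
    exact ⟨by rw [ha_def]; linarith, by rw [ha_def]; linarith⟩
  have hca : c < hfun f j ε a := hsub hau
  set b := max b₀ (a + 1) with hb_def
  have hab : a ≤ b := by
    have : a + 1 ≤ b := le_max_right _ _
    linarith
  have hcb : hfun f j ε b < c := hb₀ b (le_max_left _ _)
  have hcont : ContinuousOn (hfun f j ε) (Icc a b) :=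
    (continuousOn_hfun hj hdiff).mono fun s hs => lt_of_lt_of_le hau.1 hs.1
  -- the root set in `[a,b]`
  set R := Icc a b ∩ hfun f j ε ⁻¹' {c} with hR_def
  have hRclosed : IsClosed R := hcont.preimage_isClosed_of_isClosed isClosed_Icc isClosed_singleton
  have hRne : R.Nonempty := by
    obtain ⟨s, hs, hsv⟩ := intermediate_value_Icc' hab hcont ⟨hcb.le, hca.le⟩
    exact ⟨s, hs, hsv⟩
  have hRbdd : BddAbove R := bddAbove_Icc.mono inter_subset_left
  have hrR : sSup R ∈ R := hRclosed.csSup_mem hRne hRbdd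
  refine ⟨sSup R, lt_of_lt_of_le hau.1 hrR.1.1, hrR.2, fun s hs hsv => ?_⟩
  by_cases hsb : s ≤ b
  · have hsR : s ∈ R := ⟨⟨le_trans hrR.1.1 hs.le, hsb⟩, hsv⟩
    exact absurd (le_csSup hRbdd hsR) (not_le.mpr hs)
  · exact absurd hsv (hb₀ s (le_trans (le_max_left _ _) (le_of_lt (not_le.mp hsb)))).ne

/-- **(3.70), proof p. 20**: beyond the largest root, `h(s) ≤ h(r_ε)` for every `s > r_ε` (else the
intermediate value theorem and (3.68) produce a larger root). [cite: Xu2024NSLinfty, (3.70) p.19–20] -/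
theorem hfun_le_of_isLargestRoot (hj : 0 < j) (hL : 0 < L) (hε : 0 < ε)
    (hdiff : ∀ s, 2 * j ≤ s → DifferentiableAt ℝ f s)
    (hlim : Tendsto (fun s => f s / s) atTop (𝓝 L)) {r : ℝ} (hr : IsLargestRoot f L j ε r)
    {s : ℝ} (hs : r < s) : hfun f j ε s ≤ hfun f j ε r := by
  obtain ⟨hrj, hrv, hmax⟩ := hr
  rw [hrv]
  by_contra hlt
  push Not at hlt
  obtain ⟨b₀, _, hb₀⟩ := exists_forall_ge_hfun_lt (ε := ε) hj hL hε hlim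
  set b := max b₀ (s + 1) with hb_def
  have hsb : s ≤ b := by
    have : s + 1 ≤ b := le_max_right _ _
    linarith
  have hcb : hfun f j ε b < (1 + ε) * L := hb₀ b (le_max_left _ _)
  have hcont : ContinuousOn (hfun f j ε) (Icc s b) :=
    (continuousOn_hfun hj hdiff).mono fun t ht => lt_of_lt_of_le (lt_trans hrj hs) ht.1
  obtain ⟨t, ht, htv⟩ := intermediate_value_Icc' hsb hcont ⟨hcb.le, hlt.le⟩
  exact hmax t (lt_of_lt_of_le hs ht.1) htv

/-- **(3.70) second half / (3.71) p. 20**: at a largest root `h′(r_ε) ≤ 0` (one-sided slope limit of a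
function not exceeding `h(r_ε)` on `(r_ε,∞)`), i.e. `f′(r_ε) ≤ f(r_ε)((1−ε)/r_ε + ε/(r_ε−2j))` after
expanding `h′ = (f′ − f·((1−ε)/s + ε/(s−2j)))/(s^{1−ε}(s−2j)^ε)`. [cite: Xu2024NSLinfty, (3.70)–(3.71) p.19–20] -/
theorem deriv_le_of_isLargestRoot (hj : 0 < j) (hL : 0 < L) (hε : 0 < ε)
    (hdiff : ∀ s, 2 * j ≤ s → DifferentiableAt ℝ f s)
    (hlim : Tendsto (fun s => f s / s) atTop (𝓝 L)) {r : ℝ} (hr : IsLargestRoot f L j ε r) :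
    deriv f r ≤ f r * ((1 - ε) / r + ε / (r - 2 * j)) := by
  have hrj : 2 * j < r := hr.1
  have hr0 : 0 < r := by linarith
  have hr2 : 0 < r - 2 * j := by linarith
  -- the derivative of `h` at `r`
  set G : ℝ := r ^ (1 - ε) * (r - 2 * j) ^ ε with hG_def
  have hG : 0 < G := den_pos (ε := ε) hj hrj
  set κ : ℝ := (1 - ε) / r + ε / (r - 2 * j) with hκ_def
  have hg1 : HasDerivAt (fun s : ℝ => s ^ (1 - ε)) ((1 - ε) * r ^ (1 - ε - 1)) r :=
    Real.hasDerivAt_rpow_const (Or.inl hr0.ne')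
  have hg2 : HasDerivAt (fun s : ℝ => (s - 2 * j) ^ ε) (1 * ε * (r - 2 * j) ^ (ε - 1)) r :=
    ((hasDerivAt_id r).sub_const (2 * j)).rpow_const (Or.inl hr2.ne')
  have hg := hg1.mul hg2
  set G' : ℝ := (1 - ε) * r ^ (1 - ε - 1) * (r - 2 * j) ^ ε + r ^ (1 - ε) * (1 * ε * (r - 2 * j) ^ (ε - 1))
    with hG'_def
  have hG'eq : G' = G * κ := by
    rw [hG'_def, hG_def, hκ_def, Real.rpow_sub_one hr0.ne', Real.rpow_sub_one hr2.ne']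
    field_simp
  have hfd : HasDerivAt f (deriv f r) r := (hdiff r hrj.le).hasDerivAt
  have hh : HasDerivAt (hfun f j ε) ((deriv f r * G - f r * G') / G ^ 2) r :=
    hfd.div hg hG.ne'
  -- one-sided slope limit is `≤ 0`
  have hslope : Tendsto (slope (hfun f j ε) r) (𝓝[>] r) (𝓝 ((deriv f r * G - f r * G') / G ^ 2)) := by
    have hw : HasDerivWithinAt (hfun f j ε) ((deriv f r * G - f r * G') / G ^ 2) (Ioi r) r :=
      hh.hasDerivWithinAt
    exact (hasDerivWithinAt_iff_tendsto_slope' (lt_irrefl r)).mp hw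
  have hev : ∀ᶠ s in 𝓝[>] r, slope (hfun f j ε) r s ≤ 0 := by
    filter_upwards [self_mem_nhdsWithin] with s hs
    rw [slope_def_field]
    exact div_nonpos_of_nonpos_of_nonneg
      (sub_nonpos.mpr (hfun_le_of_isLargestRoot hj hL hε hdiff hlim hr hs)) (sub_nonneg.mpr hs.le)
  have hle : (deriv f r * G - f r * G') / G ^ 2 ≤ 0 := le_of_tendsto hslope hev
  have hnum : deriv f r * G - f r * G' ≤ 0 := by
    have := (div_le_iff₀ (pow_pos hG 2)).mp hle
    simpa using this
  rw [hG'eq] at hnum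
  have hkey : G * (deriv f r - f r * κ) ≤ 0 := by nlinarith
  by_contra hcon
  have : 0 < G * (deriv f r - f r * κ) := mul_pos hG (by linarith)
  linarith

end LargestRoot

/-- **Step 11 holds** — (3.67)–(3.69) and the inequality half of (3.70)/(3.71), p. 19–20: under the
parameter regime, the `f`-properties of p. 9, `ln‖u‖_∞ > 0` and (3.53), for every `ε ∈ (0,1)` the
largest root `r_ε` of (3.69) EXISTS (IVT on `(2j,∞)`: `h → +∞` at `2j⁺` since `f(2j) > 0`, `h → ln‖u‖_∞
< (1+ε)ln‖u‖_∞` at `∞` by (1.28); the root set is compact) and satisfies (3.71) (`h ≤ h(r_ε)` beyond the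
largest root, so the one-sided derivative `h′(r_ε) ≤ 0`). Classical; the skeleton's flag «true» for
Step 11 is now kernel-certified. The divergence half of (3.70) (`Step_12`, #16's locator) is untouched.
[cite: Xu2024NSLinfty, (3.67)–(3.71) p.19–20] -/
theorem step_11_holds : Step_11 := by
  intro N q η j f L hP hF hL h353 ε hε _hε1
  have hq0 : 0 < q := by linarith [hP.q_gt, (Nat.cast_nonneg N : (0 : ℝ) ≤ N)]
  have hj : 0 < j := lt_trans hq0 hP.q_lt_j
  have hq2 : 2 * lam N < 2 * q := by linarith [hP.two_lam_lt, hP.q_gt, hP.lam_pos]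
  have hdiff : ∀ s, 2 * j ≤ s → DifferentiableAt ℝ f s := fun s hs =>
    ((hF.smooth.differentiableOn (by simp)).differentiableAt
      (Ioi_mem_nhds (by linarith [hP.q_lt_j])))
  have hpos : 0 < f (2 * j) := h353 (2 * j) (by linarith [hP.q_lt_j])
  exact ⟨LargestRoot.exists_isLargestRoot hj hL hε hdiff hpos hF.tendsto_div,
    fun r hr => LargestRoot.deriv_le_of_isLargestRoot hj hL hε hdiff hF.tendsto_div hr⟩

/-- **(3.70) second half / (3.71) over the printed premises holds** (`RootDerivative_asPrinted`, the
referee's verbatim companion of Step 11's derivative clause): at every largest root `r_ε`,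
`f′(r_ε) ≤ f(r_ε)((1−ε)/r_ε + ε/(r_ε − 2j))`. [cite: Xu2024NSLinfty, (3.70)–(3.71) p.19–20] -/
theorem rootDerivative_asPrinted_holds : RootDerivative_asPrinted := by
  intro f L q j hPr ε hε r hr
  have hj : 0 < j := lt_trans hPr.q_pos hPr.q_lt_j
  have hdiff : ∀ s, 2 * j ≤ s → DifferentiableAt ℝ f s := fun s hs =>
    hPr.diff s (by linarith [hPr.q_lt_j])
  exact LargestRoot.deriv_le_of_isLargestRoot hj hPr.L_pos hε.1 hdiff hPr.lim hr

/-! ## Discharge of Step 14 (D-0026 debt pass, ns-claims-typist-4 g5, 2026-08-27; APPEND-ONLY —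
no statement, definition, locator or class above is touched; #16's locator `Step_12` stands).
«The parameters exist» is pure real arithmetic over the file's own `lam`, `alpha`, `mq`, `cq`, `cqj`,
`bracket`, `theta`: the witnesses are `q = 2(N+2)` and a `j` exceeding the printed lower bounds. -/

namespace Params

/-- `λ_N > 0` for `N ≥ 3`. [folklore] -/
private theorem lam_pos {N : ℕ} (hN : 3 ≤ N) : 0 < lam N := by
  have hN' : (3 : ℝ) ≤ N := by exact_mod_cast hN
  unfold lam
  positivity

/-- `2λ_N < N + 2` for `N ≥ 3` (i.e. `N > 2`). [folklore] -/
private theorem two_lam_lt {N : ℕ} (hN : 3 ≤ N) : 2 * lam N < (N : ℝ) + 2 := by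
  have hN' : (3 : ℝ) ≤ N := by exact_mod_cast hN
  have hN0 : (0 : ℝ) < N := by linarith
  unfold lam
  rw [← lt_div_iff₀' (by norm_num : (0:ℝ) < 2), div_lt_div_iff₀ hN0 (by norm_num : (0:ℝ) < 2)]
  nlinarith

/-- With `q = 2(N+2)`: `α = 1/(N+2)`. [folklore] -/
private theorem alpha_eq {N : ℕ} (hN : 3 ≤ N) : alpha N (2 * ((N : ℝ) + 2)) = 1 / ((N : ℝ) + 2) := by
  have hN' : (3 : ℝ) ≤ N := by exact_mod_cast hN
  have hM : (0 : ℝ) < (N : ℝ) + 2 := by linarith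
  unfold alpha
  field_simp
  ring

/-- With `q = 2(N+2)`: `m_q = 2(N+2) − 2λ_N`. [folklore] -/
private theorem mq_eq {N : ℕ} (hN : 3 ≤ N) :
    mq N (2 * ((N : ℝ) + 2)) = 2 * ((N : ℝ) + 2) - 2 * lam N := by
  have hN' : (3 : ℝ) ≤ N := by exact_mod_cast hN
  have hM : (0 : ℝ) < (N : ℝ) + 2 := by linarith
  unfold mq
  rw [alpha_eq hN]
  field_simp

end Params
set_option maxHeartbeats 400000 in -- buildfix (bf3-g26): 160k/180k FAIL, 200k PASS at accept time; line-neutral budget line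
/-- **Step 14 holds** — the parameters exist (p. 21 l. 55–57 «In summary, the order in which we pick our
parameters …»; (3.29), (3.49)–(3.52) p. 15–16, (3.64) p. 18, (3.74) p. 21): for `N ≥ 3` and `η > 0`
there are `q`, `j` with every clause of `ParamFacts`. Explicit witnesses: `q = 2(N+2)` (so
`α = 1/(N+2)` and `m_q = 2(N+2) − 2λ_N`, whence `N + 2 < m_q < 2q` from `2λ_N < N + 2`), and `j`
larger than the bounds (3.64), (3.74), `q m_q/λ_N + η/(2λ_N)`, `4q` and `2m_q` (so the bracket (3.63)
is positive on `[2j,∞)` and the exponent of p. 21 is positive). Pure real arithmetic; #16's locator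
`Step_12` is untouched. [cite: Xu2024NSLinfty, p.21 l.55–57; (3.49)–(3.52) p.15–16; (3.64) p.18; (3.74) p.21] -/
theorem step_14_holds : Step_14 := by
  intro N hN η hη
  have hN' : (3 : ℝ) ≤ N := by exact_mod_cast hN
  set M : ℝ := (N : ℝ) + 2 with hM_def
  have hM : 0 < M := by rw [hM_def]; linarith
  set q : ℝ := 2 * M with hq_def
  have hq : 0 < q := by rw [hq_def]; linarith
  have hlam : 0 < lam N := Params.lam_pos hN
  have h2lam : 2 * lam N < M := Params.two_lam_lt hN
  have hα : alpha N q = 1 / M := Params.alpha_eq hN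
  have hαpos : 0 < alpha N q := by rw [hα]; exact one_div_pos.mpr hM
  have hmq : mq N q = 2 * M - 2 * lam N := Params.mq_eq hN
  have hmq_pos : 0 < mq N q := by rw [hmq]; linarith
  have hqlam : 0 < q - lam N := by rw [hq_def]; linarith
  -- the two printed lower bounds for `j` and two convenient ones
  set b5 : ℝ := q + (mq N q - lam N + Real.sqrt ((2 * q - lam N) ^ 2 + mq N q * (mq N q - 2 * lam N))) / 2
    with hb5_def
  set b6 : ℝ := (mq N q - 2 * lam N) * q / lam N + 2 * lam N + η / (2 * lam N) with hb6_def
  set b7 : ℝ := q * mq N q / lam N + η / (2 * lam N) with hb7_def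
  have hb7 : 0 ≤ b7 := by
    rw [hb7_def]
    exact add_nonneg (div_nonneg (mul_nonneg hq.le hmq_pos.le) hlam.le)
      (div_nonneg hη.le (by linarith))
  set j : ℝ := |b5| + |b6| + b7 + 4 * q + 2 * mq N q + 1 with hj_def
  have hj5 : b5 < j := by
    have := le_abs_self b5; have := abs_nonneg b6; rw [hj_def]; linarith
  have hj6 : b6 < j := by
    have := le_abs_self b6; have := abs_nonneg b5; rw [hj_def]; linarith
  have hj7 : b7 < j := by
    have := abs_nonneg b5; have := abs_nonneg b6; rw [hj_def]; linarith
  have hj4q : 4 * q < j := by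
    have := abs_nonneg b5; have := abs_nonneg b6; rw [hj_def]; linarith
  have hj2mq : 2 * mq N q < j := by
    have := abs_nonneg b5; have := abs_nonneg b6; rw [hj_def]; linarith
  have hjq : q < j := by linarith
  have hjmq : mq N q < j := by linarith
  have hj0 : 0 < j := by linarith
  refine ⟨q, j, ?_⟩
  refine
    { three_le := hN
      q_gt := by show M < q; rw [hq_def]; linarith
      mq_lt := by rw [hmq, hq_def]; linarith
      eta_pos := hη
      j_gt := hj5
      j_gt' := hj6
      lam_pos := hlam
      two_lam_lt := h2lam
      alpha_pos := hαpos
      mq_gt := by show M < mq N q; rw [hmq]; linarith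
      mq_lt_j := hjmq
      q_lt_j := hjq
      bracket_pos := ?_
      theta_pos := ?_
      cq_pos := ?_
      cqj_pos := ?_ }
  · -- (3.63): the bracket is positive on `[2j, ∞)`
    intro r hr
    have hD : 0 < 2 * (q - lam N) := by linarith
    have hjm : 0 ≤ j - mq N q := by linarith
    have hmono : (j - mq N q) * (2 * j - 2 * q) ≤ (j - mq N q) * (r - 2 * q) :=
      mul_le_mul_of_nonneg_left (by linarith) hjm
    have hkey : j * (2 * (q - lam N)) < (j - mq N q) * (2 * j - 2 * q) := by
      have h1 : j / 2 ≤ j - mq N q := by linarith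
      have h2 : j / 2 ≤ j - q := by linarith
      have h3 : j / 2 * (j / 2) ≤ (j - mq N q) * (j - q) :=
        mul_le_mul h1 h2 (by linarith) hjm
      nlinarith
    have hlt : j < (j - mq N q) * (r - 2 * q) / (2 * (q - lam N)) := by
      rw [lt_div_iff₀ hD]; linarith
    show 0 < -j + (j - mq N q) * (r - 2 * q) / (2 * (q - lam N))
    linarith
  · -- the exponent of p. 21 is positive
    show 0 < lam N * j / (q - lam N) + 2 * lam N - (2 * q * mq N q + η) / (2 * (q - lam N))
    have h2lam0 : 0 < 2 * lam N := by linarith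
    have hnum : 2 * q * mq N q + η < 2 * lam N * j := by
      have e : b7 * (2 * lam N) = 2 * q * mq N q + η := by
        rw [hb7_def]
        field_simp
      have := mul_lt_mul_of_pos_right hj7 h2lam0
      rw [e] at this
      linarith
    have h1 : (2 * q * mq N q + η) / (2 * (q - lam N)) < lam N * j / (q - lam N) := by
      have e : lam N * j / (q - lam N) = 2 * lam N * j / (2 * (q - lam N)) := by
        rw [mul_assoc, mul_div_mul_left _ _ (two_ne_zero)]
      rw [e]
      exact div_lt_div_of_pos_right hnum (by linarith)
    linarith
  · have hx : 0 < mq N q * alpha N q := mul_pos hmq_pos hαpos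
    have hx2 : 0 < 2 + mq N q * alpha N q := by linarith
    exact div_pos (mul_pos hx2 hlam) (mul_pos hαpos hqlam)
  · intro j' hj'
    have hx : 0 < j' * alpha N q := mul_pos hj' hαpos
    have hx2 : 0 < 2 + j' * alpha N q := by linarith
    exact div_pos (mul_pos hx2 hlam) (mul_pos hαpos hqlam)

/-! ## Discharge of Step 8 = Claim 3.3 (D-0026 debt pass, ns-claims-typist-10 g5, 2026-08-27; APPEND-ONLY —
no statement, definition, locator or class above is touched; #16's locator `Step_12` stands).
The printed proof of Claim 3.3 (p. 15, (3.47)–(3.48)): put `j = m_q/2` in (3.44), let `ℓ → ∞`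
(`‖u‖_ℓ → ‖u‖_∞`, i.e. `f(ℓ)/ℓ → L`), and use the interpolation (1.19) between `2λ_N` and `2q` on the
residual POSITIVE power `jq/((r−2j)(q−λ_N))` of `‖u‖_{2q}`; the two `‖u‖_∞^{∓ j/(r−2j)}` factors cancel and
the choice `2j = m_q` kills the `‖u‖_{2q}` factor, leaving (3.46) with `c(N,q) = cq N q`. -/

namespace Claim33

/-- `ℓ/(ℓ − r) → 1` as `ℓ → ∞`. [folklore] -/
private theorem tendsto_div_sub_atTop (r : ℝ) : Tendsto (fun ℓ : ℝ => ℓ / (ℓ - r)) atTop (𝓝 1) := by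
  have h1 : Tendsto (fun ℓ : ℝ => 1 - r * ℓ⁻¹) atTop (𝓝 (1 - r * 0)) :=
    tendsto_const_nhds.sub (tendsto_const_nhds.mul tendsto_inv_atTop_zero)
  rw [mul_zero, sub_zero] at h1
  have h2 : Tendsto (fun ℓ : ℝ => (1 - r * ℓ⁻¹)⁻¹) atTop (𝓝 1) := by simpa using h1.inv₀ one_ne_zero
  refine h2.congr' ?_
  filter_upwards [eventually_gt_atTop (0 : ℝ), eventually_gt_atTop r] with ℓ hℓ0 hℓr
  have hℓ : ℓ ≠ 0 := hℓ0.ne'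
  have hℓr' : ℓ - r ≠ 0 := by linarith
  field_simp

/-- The exponent algebra of (3.47)–(3.48) at `2j₀ = m_q` (i.e. `j₀ α q = q − 2λ_N`): the residual exponent
of `‖u‖_{2q}` in (3.47) equals `j₀ q/((r−2j₀)(q−λ_N))`. [cite: Xu2024NSLinfty, (3.47)–(3.48) p.15] -/
private theorem exponent_eq {α lam q r j₀ : ℝ} (hα : α ≠ 0) (hqlam : q - lam ≠ 0)
    (hrj : r - 2 * j₀ ≠ 0) (hj : j₀ * α * q = q - 2 * lam) :
    4 / ((r - 2 * j₀) * α) - (j₀ * α + 2) * q / (α * (q - lam) * (r - 2 * j₀))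
      = j₀ * q / ((r - 2 * j₀) * (q - lam)) := by
  rw [div_sub_div _ _ (mul_ne_zero hrj hα) (mul_ne_zero (mul_ne_zero hα hqlam) hrj),
    div_eq_div_iff (mul_ne_zero (mul_ne_zero hrj hα) (mul_ne_zero (mul_ne_zero hα hqlam) hrj))
      (mul_ne_zero hrj hqlam)]
  linear_combination (-2 * α * (r - 2 * j₀) ^ 2 * (q - lam)) * hj

end Claim33

/-- **Step 8 = Claim 3.3 holds** ((3.45)–(3.48) p. 15): over the `f`-level setting of pp. 15–21
(`FSetting`: the parameter regime, `K > 0`, the `f`-properties (3.11)–(3.14)/(1.19)/(1.28) of p. 9,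
`ln‖u‖_∞ > 0`, and (3.44) for all admissible `(j, r, ℓ)`), the bound (3.46) holds for every `r > m_q`,
with `c(N,ν,q) = K(m_q/2)` and `c(N,q) = cq N q`. Proof as printed: (3.44) at `j = m_q/2`, `ℓ → ∞`
(`FProps.tendsto_div`, `ge_of_tendsto`), then (1.19) = `FProps.interp` at `(2λ_N, 2q)` on the positive
residual exponent (`Claim33.exponent_eq`); pure real analysis, no solution in sight. #16's locator
`Step_12` is untouched. [cite: Xu2024NSLinfty, Claim 3.3 (3.45)–(3.48) p.15] -/
theorem step_8_holds : Step_8 := by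
  intro N q η j K f L hF r hr
  have hP := hF.params
  have hFp := hF.fprops
  have hlam : 0 < lam N := hP.lam_pos
  have hq : (N : ℝ) + 2 < q := hP.q_gt
  have h2lam : 2 * lam N < (N : ℝ) + 2 := hP.two_lam_lt
  have hqpos : 0 < q := by linarith
  have hqlam : 0 < q - lam N := by linarith
  have h2lam_q : 2 * lam N < 2 * q := by linarith
  have hα : 0 < alpha N q := hP.alpha_pos
  have hmq : (N : ℝ) + 2 < mq N q := hP.mq_gt
  set j₀ : ℝ := mq N q / 2 with hj₀
  have hmq2 : mq N q = 2 * j₀ := by rw [hj₀]; ring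
  have hj₀pos : 0 < j₀ := by rw [hj₀]; linarith
  have hr2j : 2 * j₀ < r := by linarith
  have hr2lam : 2 * lam N < r := by linarith
  have hrj : 0 < r - 2 * j₀ := by linarith
  have hrpos : 0 < r := by linarith
  -- `j₀ α q = q − 2λ_N` (definition (3.45) of `m_q`)
  have hjαq : j₀ * alpha N q * q = q - 2 * lam N := by
    rw [hj₀]
    unfold mq
    field_simp
  -- abbreviations
  set E : ℝ := 4 / ((r - 2 * j₀) * alpha N q)
      - (j₀ * alpha N q + 2) * q / (alpha N q * (q - lam N) * (r - 2 * j₀)) with hE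
  set c₁ : ℝ := j₀ / (r - 2 * j₀) with hc₁
  set A : ℝ := Real.log (8 * Real.sqrt N) + Real.log (K j₀) / (r - 2 * j₀)
      + cqj N q j₀ / (r - 2 * j₀) * (f (2 * lam N) / (2 * lam N)) + E * (f (2 * q) / (2 * q)) with hA
  have hE_eq : E = j₀ * q / ((r - 2 * j₀) * (q - lam N)) :=
    Claim33.exponent_eq hα.ne' hqlam.ne' hrj.ne' hjαq
  have hE_nn : 0 ≤ E := by rw [hE_eq]; positivity
  -- (i) (3.44) at `j = j₀` for every `ℓ > r`, and the limit `ℓ → ∞`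
  have hlim : L ≤ A - c₁ * L + ((r - j₀) / (r - 2 * j₀) + c₁) * (f r / r) := by
    have hev : ∀ᶠ ℓ in atTop, L ≤ A - j₀ * ℓ / ((r - 2 * j₀) * (ℓ - r)) * (f ℓ / ℓ)
        + ((r - j₀) / (r - 2 * j₀) + j₀ * ℓ / ((r - 2 * j₀) * (ℓ - r))) * (f r / r) := by
      filter_upwards [eventually_gt_atTop r] with ℓ hℓ
      have h := hF.ineq344 j₀ r ℓ hj₀pos hr2lam hr2j hℓ
      rw [hA, hE]
      linarith
    have hcℓ : Tendsto (fun ℓ : ℝ => j₀ * ℓ / ((r - 2 * j₀) * (ℓ - r))) atTop (𝓝 c₁) := by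
      have hfun : (fun ℓ : ℝ => j₀ * ℓ / ((r - 2 * j₀) * (ℓ - r)))
          = fun ℓ => j₀ / (r - 2 * j₀) * (ℓ / (ℓ - r)) := by
        funext ℓ
        exact (div_mul_div_comm j₀ (r - 2 * j₀) ℓ (ℓ - r)).symm
      rw [hfun, hc₁]
      simpa using (tendsto_const_nhds (x := j₀ / (r - 2 * j₀))).mul (Claim33.tendsto_div_sub_atTop r)
    have htend : Tendsto (fun ℓ : ℝ => A - j₀ * ℓ / ((r - 2 * j₀) * (ℓ - r)) * (f ℓ / ℓ)
        + ((r - j₀) / (r - 2 * j₀) + j₀ * ℓ / ((r - 2 * j₀) * (ℓ - r))) * (f r / r)) atTop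
        (𝓝 (A - c₁ * L + ((r - j₀) / (r - 2 * j₀) + c₁) * (f r / r))) :=
      (tendsto_const_nhds.sub (hcℓ.mul hFp.tendsto_div)).add
        ((tendsto_const_nhds.add hcℓ).mul tendsto_const_nhds)
    exact ge_of_tendsto htend hev
  -- (ii) `((r−j₀)/(r−2j₀) + j₀/(r−2j₀))·(f r/r) = f r/(r−2j₀)`
  have hfr : ((r - j₀) / (r - 2 * j₀) + c₁) * (f r / r) = f r / (r - 2 * j₀) := by
    rw [hc₁]
    field_simp
    ring
  -- (iii) interpolation (1.19) between `2λ_N` and `2q` on the positive residual exponent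
  have hint : f (2 * q) ≤ f (2 * lam N) + (2 * q - 2 * lam N) * L :=
    hFp.interp (2 * lam N) (2 * q) le_rfl h2lam_q
  have hEterm : E * (f (2 * q) / (2 * q)) ≤ E / (2 * q) * f (2 * lam N) + c₁ * L := by
    have h1 : E * (f (2 * q) / (2 * q)) ≤ E * ((f (2 * lam N) + (2 * q - 2 * lam N) * L) / (2 * q)) :=
      mul_le_mul_of_nonneg_left (div_le_div_of_nonneg_right hint (by linarith)) hE_nn
    have h2 : E * ((f (2 * lam N) + (2 * q - 2 * lam N) * L) / (2 * q))
        = E / (2 * q) * f (2 * lam N) + (E * (2 * q - 2 * lam N) / (2 * q)) * L := by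
      field_simp
    have h3 : E * (2 * q - 2 * lam N) / (2 * q) = c₁ := by
      rw [hE_eq, hc₁]
      field_simp
    rw [h2, h3] at h1
    exact h1
  -- (iv) the coefficients of `f(2λ_N)` add up to `cq N q/((r − m_q)·2λ_N)`
  have hcoef : cqj N q j₀ / (r - 2 * j₀) * (f (2 * lam N) / (2 * lam N)) + E / (2 * q) * f (2 * lam N)
      = cq N q * (f (2 * lam N) / (2 * lam N)) / (r - 2 * j₀) := by
    rw [hE_eq]
    unfold cqj cq
    rw [hmq2]
    field_simp
    ring
  -- assemble
  rw [hmq2]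
  have hfinal : L ≤ Real.log (8 * Real.sqrt N) + Real.log (K j₀) / (r - 2 * j₀)
      + cq N q * (f (2 * lam N) / (2 * lam N)) / (r - 2 * j₀) + f r / (r - 2 * j₀) := by
    rw [hfr, hA] at hlim
    linarith
  have hsplit : Real.log (8 * Real.sqrt N)
      + (Real.log (K j₀) + cq N q * (f (2 * lam N) / (2 * lam N)) + f r) / (r - 2 * j₀)
      = Real.log (8 * Real.sqrt N) + Real.log (K j₀) / (r - 2 * j₀)
      + cq N q * (f (2 * lam N) / (2 * lam N)) / (r - 2 * j₀) + f r / (r - 2 * j₀) := by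
    rw [add_div, add_div]
    ring
  rw [hsplit]
  exact hfinal

/-! ## Discharge of Step 10 = (3.57)–(3.61) with (3.65)–(3.66) (D-0026 debt pass, ns-claims-typist-10 g5,
2026-08-27; APPEND-ONLY — no statement, definition, locator or class above is touched; #16's locator
`Step_12` stands). The printed derivation (p. 17–19): (3.44) at the setting's `j` with `r > 2j > 2q`
((3.58)), the interpolation (3.59) between `2q < r < ℓ` (= convexity of `f`) applied to the NEGATIVE power
`q(m_q − j)/((r−2j)(q−λ_N))` of `‖u‖_{2q}` (`j > m_q`, (3.60)), which turns every `ℓ`-term of (3.57) into the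
slope `(f(ℓ) − f(r))/(ℓ − r)` with the coefficient `bracket/(r−2j)` of (3.61); the limit `ℓ → r⁺` gives
(3.61) with `f′(r)`, and (3.65) trades `ln(8√N)` for the `η`-term of (3.66). -/

namespace Bound366Proof

/-- The exponent of `‖u‖_{2q}` in (3.57): `4/((r−2j)α) − (jα+2)q/(α(q−λ_N)(r−2j)) = q(m_q − j)/((r−2j)(q−λ_N))`
((3.45): `m_q = 2(q − 2λ_N)/(αq)`). [cite: Xu2024NSLinfty, (3.57) p.17] -/
private theorem exponent2q_eq {N : ℕ} {q r j : ℝ} (hα : alpha N q ≠ 0) (hq : q ≠ 0)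
    (hqlam : q - lam N ≠ 0) (hrj : r - 2 * j ≠ 0) :
    4 / ((r - 2 * j) * alpha N q) - (j * alpha N q + 2) * q / (alpha N q * (q - lam N) * (r - 2 * j))
      = q * (mq N q - j) / ((r - 2 * j) * (q - lam N)) := by
  unfold mq
  rw [div_sub_div _ _ (mul_ne_zero hrj hα) (mul_ne_zero (mul_ne_zero hα hqlam) hrj),
    div_eq_div_iff (mul_ne_zero (mul_ne_zero hrj hα) (mul_ne_zero (mul_ne_zero hα hqlam) hrj))
      (mul_ne_zero hrj hqlam)]
  field_simp
  ring

/-- The `ℓ`-terms of (3.44)/(3.57) rewritten through the slope `S = (f(ℓ) − f(r))/(ℓ − r)`: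
`−jℓ/((r−2j)(ℓ−r))·(f(ℓ)/ℓ) + ((r−j)/(r−2j) + jℓ/((r−2j)(ℓ−r)))·(f(r)/r) = f(r)/(r−2j) − j S/(r−2j)`.
[cite: Xu2024NSLinfty, (3.57)→(3.61) p.17–18] -/
private theorem ell_terms_eq {j r ℓ fr fℓ : ℝ} (hr : r ≠ 0) (hℓ : ℓ ≠ 0) (hℓr : ℓ - r ≠ 0) :
    -(j * ℓ / ((r - 2 * j) * (ℓ - r))) * (fℓ / ℓ)
        + ((r - j) / (r - 2 * j) + j * ℓ / ((r - 2 * j) * (ℓ - r))) * (fr / r)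
      = fr / (r - 2 * j) - j / (r - 2 * j) * ((fℓ - fr) / (ℓ - r)) := by
  field_simp
  ring

end Bound366Proof

/-- **Step 10 holds** — (3.57)–(3.61) p. 17–18 and (3.66) p. 19: over the `f`-level setting (`FSetting`) and
under (3.65) (`Small365`), the bound (3.66) (`Bound366`) holds for every `r > 2j`. Proof as printed: (3.44)
= `FSetting.ineq344` at `(j, r, ℓ)`, `ℓ > r` (`r > 2j > 2q > 2λ_N` by `ParamFacts.q_lt_j`, `q_gt`,
`two_lam_lt`); (3.59) = `ConvexOn.slope_mono_adjacent` for `FProps.convex` at `2q < r < ℓ`, used on the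
negative power of `‖u‖_{2q}` (`Bound366Proof.exponent2q_eq`, `ParamFacts.mq_lt_j`); the `ℓ`-terms collapse to
the slope (`Bound366Proof.ell_terms_eq`) with the printed coefficient `bracket N q j r/(r−2j)`; `ℓ → r⁺`
(`hasDerivAt_iff_tendsto_slope`, `FProps.smooth`) yields (3.61) with `deriv f r`; (3.65) at `r` gives (3.66).
Pure real analysis; #16's locator `Step_12` is untouched. [cite: Xu2024NSLinfty, (3.57)–(3.61) p.17–18; (3.65)–(3.66) p.19] -/
theorem step_10_holds : Step_10 := by
  intro N q η j K f L hF h365 r hr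
  have hP := hF.params
  have hFp := hF.fprops
  have hlam : 0 < lam N := hP.lam_pos
  have hq : (N : ℝ) + 2 < q := hP.q_gt
  have h2lam : 2 * lam N < (N : ℝ) + 2 := hP.two_lam_lt
  have hqpos : 0 < q := by linarith
  have hqlam : 0 < q - lam N := by linarith
  have hα : 0 < alpha N q := hP.alpha_pos
  have hqj : q < j := hP.q_lt_j
  have hmqj : mq N q < j := hP.mq_lt_j
  have hjpos : 0 < j := by linarith
  have hr2q : 2 * q < r := by linarith
  have hr2lam : 2 * lam N < r := by linarith
  have hrj : 0 < r - 2 * j := by linarith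
  have hrpos : 0 < r := by linarith
  have hr2q' : 0 < r - 2 * q := by linarith
  -- differentiability of `f` at `r` («f is a smooth function», p. 9) and the slope limit `ℓ → r⁺`
  have hdiff : DifferentiableAt ℝ f r :=
    (hFp.smooth.differentiableOn (by simp)).differentiableAt (Ioi_mem_nhds hr2lam)
  have hslope : Tendsto (fun ℓ => (f ℓ - f r) / (ℓ - r)) (𝓝[>] r) (𝓝 (deriv f r)) := by
    have h := (hasDerivAt_iff_tendsto_slope.mp hdiff.hasDerivAt).mono_left (nhdsGT_le_nhdsNE r)
    refine h.congr' (Eventually.of_forall fun ℓ => ?_)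
    rw [slope_def_field]
  -- abbreviations: the `ℓ`-free part of (3.61) and the slope coefficient
  set A : ℝ := Real.log (8 * Real.sqrt N) + Real.log (K j) / (r - 2 * j)
      + cqj N q j / (r - 2 * j) * (f (2 * lam N) / (2 * lam N))
      + f r / (r - 2 * j) * (1 - (j - mq N q) / (2 * (q - lam N))) with hA
  set B : ℝ := bracket N q j r / (r - 2 * j) with hB
  -- the exponent of `‖u‖_{2q}` is NEGATIVE (j > m_q)
  have hE_eq := Bound366Proof.exponent2q_eq (N := N) (r := r) (j := j) hα.ne' hqpos.ne' hqlam.ne' hrj.ne'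
  have hE_np : 4 / ((r - 2 * j) * alpha N q)
      - (j * alpha N q + 2) * q / (alpha N q * (q - lam N) * (r - 2 * j)) ≤ 0 := by
    rw [hE_eq]
    apply div_nonpos_of_nonpos_of_nonneg
    · nlinarith
    · positivity
  -- (i) for every `ℓ > r`: (3.44) + (3.59) ⇒ the pre-limit form of (3.61)
  have hpre : ∀ ℓ, r < ℓ → L ≤ A + B * ((f ℓ - f r) / (ℓ - r)) := by
    intro ℓ hℓ
    have hℓpos : 0 < ℓ := hrpos.trans hℓ
    have hℓr : 0 < ℓ - r := by linarith
    set S : ℝ := (f ℓ - f r) / (ℓ - r) with hS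
    have h344 := hF.ineq344 j r ℓ hjpos hr2lam (by linarith) hℓ
    -- (3.59): convexity of `f` on `[2λ_N, ∞)` at `2q < r < ℓ`
    have hconv : (f r - f (2 * q)) / (r - 2 * q) ≤ S :=
      hFp.convex.slope_mono_adjacent (mem_Ici.mpr (by linarith)) (mem_Ici.mpr (by linarith)) hr2q hℓ
    have hf2q : f r - (r - 2 * q) * S ≤ f (2 * q) := by
      have := (div_le_iff₀ hr2q').mp hconv
      linarith
    -- the negative power of `‖u‖_{2q}` against the lower bound on `f(2q)`
    have h2q : (4 / ((r - 2 * j) * alpha N q)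
        - (j * alpha N q + 2) * q / (alpha N q * (q - lam N) * (r - 2 * j))) * (f (2 * q) / (2 * q))
        ≤ -((j - mq N q) / (2 * (r - 2 * j) * (q - lam N))) * (f r - (r - 2 * q) * S) := by
      have h1 := mul_le_mul_of_nonpos_left (div_le_div_of_nonneg_right hf2q (by linarith : (0:ℝ) ≤ 2 * q))
        hE_np
      have h2 : (4 / ((r - 2 * j) * alpha N q)
          - (j * alpha N q + 2) * q / (alpha N q * (q - lam N) * (r - 2 * j)))
          * ((f r - (r - 2 * q) * S) / (2 * q))
          = -((j - mq N q) / (2 * (r - 2 * j) * (q - lam N))) * (f r - (r - 2 * q) * S) := by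
        rw [hE_eq]
        field_simp
        ring
      rw [h2] at h1
      exact h1
    -- the `ℓ`-terms through the slope
    have hℓterms := Bound366Proof.ell_terms_eq (fr := f r) (fℓ := f ℓ) (j := j)
      hrpos.ne' hℓpos.ne' hℓr.ne'
    -- the bracket identity of (3.61)
    have hbr : -(j / (r - 2 * j)) * S
        + -((j - mq N q) / (2 * (r - 2 * j) * (q - lam N))) * (f r - (r - 2 * q) * S)
        = f r / (r - 2 * j) * (-((j - mq N q) / (2 * (q - lam N)))) + B * S := by
      rw [hB]
      unfold bracket
      field_simp
      ring
    rw [hA]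
    linarith
  -- (ii) the limit `ℓ → r⁺`: (3.61) with `f′(r)`
  have h361 : L ≤ A + B * deriv f r := by
    have htend : Tendsto (fun ℓ => A + B * ((f ℓ - f r) / (ℓ - r))) (𝓝[>] r) (𝓝 (A + B * deriv f r)) :=
      tendsto_const_nhds.add (tendsto_const_nhds.mul hslope)
    exact ge_of_tendsto htend (eventually_nhdsWithin_of_forall fun ℓ hℓ => hpre ℓ hℓ)
  -- (iii) (3.65) at `r` removes `ln(8√N)` and inserts `η`: (3.66)
  have h65 := h365 r hr
  have hη : f r / (r - 2 * j) * (1 - (j - mq N q) / (2 * (q - lam N)))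
      + η * f r / (2 * (q - lam N) * (r - 2 * j))
      = f r / (r - 2 * j) * (1 - (j - mq N q - η) / (2 * (q - lam N))) := by
    field_simp
    ring
  have hfin : L ≤ Real.log (K j) / (r - 2 * j) + cqj N q j / (r - 2 * j) * (f (2 * lam N) / (2 * lam N))
      + B * deriv f r + f r / (r - 2 * j) * (1 - (j - mq N q - η) / (2 * (q - lam N))) := by
    rw [hA] at h361
    linarith
  have hBd : B * deriv f r = deriv f r / (r - 2 * j) * bracket N q j r := by
    rw [hB]
    ring
  rw [hBd] at hfin
  linarith

/-! ## Discharge of Step 9 — the three «otherwise (1.5) follows» branches (D-0026 debt pass, ns-claims-typist-10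
g5, 2026-08-27; APPEND-ONLY — no statement, definition, locator or class above is touched; #16's locator `Step_12`
stands). Printed arguments: ¬(3.53) p. 16 l. 10–25 (an exponent `s ≥ 2q` with `f(s) ≤ 0` inserted in (3.46));
¬(3.54) p. 16 l.−8 – p. 17 l. 6 (an `r ≥ 2q` with `r f′(r) ≤ f(r)`, whence `f(r)/r ≤ f(2λ_N)/(2λ_N)` by (3.14),
inserted in (3.46)); ¬(3.65) p. 19 l. 8–16 (an `r > 2j` with `8√N ‖u‖_r^{−ηr/(2(q−λ_N)(r−2j))} > 1` inserted in
(3.46)). Uniformity in the unknown exponent: `r − m_q ≥ 2q − m_q > 0` ((3.52)), `r/(r − m_q) ≤ 2q/(2q − m_q)`,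
`(r − 2j)/(r − m_q) ≤ 1`. -/

namespace Step9Proof

/-- `X/(r − m) ≤ max(X,0)/(2q − m)` for `r ≥ 2q > m` (sign cases). [folklore] -/
private theorem div_le_max_div {X r m q : ℝ} (hm : m < 2 * q) (hr : 2 * q ≤ r) :
    X / (r - m) ≤ max X 0 / (2 * q - m) := by
  have h1 : 0 < 2 * q - m := by linarith
  have h2 : 2 * q - m ≤ r - m := by linarith
  have h3 : 0 < r - m := by linarith
  rcases le_or_gt 0 X with hX | hX
  · rw [max_eq_left hX]
    exact div_le_div_of_nonneg_left hX h1 h2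
  · rw [max_eq_right hX.le, zero_div]
    exact div_nonpos_of_nonpos_of_nonneg hX.le h3.le

/-- `r·F/(r − m) ≤ (2q/(2q − m))·max(F,0)` for `r ≥ 2q > m > 0` (sign cases; `r/(r−m)` decreases in `r`). [folklore] -/
private theorem mul_div_le_max {F r m q : ℝ} (hm0 : 0 < m) (hm : m < 2 * q) (hr : 2 * q ≤ r) :
    r * F / (r - m) ≤ 2 * q / (2 * q - m) * max F 0 := by
  have h1 : 0 < 2 * q - m := by linarith
  have h3 : 0 < r - m := by linarith
  rcases le_or_gt 0 F with hF | hF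
  · rw [max_eq_left hF]
    have hratio : r / (r - m) ≤ 2 * q / (2 * q - m) := by
      rw [div_le_div_iff₀ h3 h1]
      nlinarith
    calc r * F / (r - m) = r / (r - m) * F := by ring
      _ ≤ 2 * q / (2 * q - m) * F := mul_le_mul_of_nonneg_right hratio hF
  · rw [max_eq_right hF.le, mul_zero]
    apply div_nonpos_of_nonpos_of_nonneg _ h3.le
    nlinarith

end Step9Proof

/-- **Step 9 holds** — the three «otherwise» reductions (¬(3.53) ⇒ (1.5), p. 16 l. 10–25; ¬(3.54) ⇒ (1.5),
p. 16 l.−8 – p. 17 l. 6 via (3.14) and Claim 3.3; ¬(3.65) ⇒ (1.5), p. 19 l. 8–16), each as the typed explicit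
bound `ln‖u‖_∞ ≤ P + Q·max(ln‖u‖_{2λ_N}, 0)` with `P, Q` depending only on `N, q, j, η` and the constants
`K(m_q/2)`, `cq N q`: in each branch the negated hypothesis supplies ONE exponent `r` with, respectively,
`f(r) ≤ 0`, `f(r) ≤ r·f(2λ_N)/(2λ_N)` (from `r f′(r) ≤ f(r)` and (3.14) = `FProps.slope_le_deriv`),
`f(r) < ln(8√N)·2(q−λ_N)(r−2j)/η`; inserted in (3.46) = `Bound346` at that `r` and bounded uniformly in `r`
(`Step9Proof.div_le_max_div`, `Step9Proof.mul_div_le_max`, `(r−2j)/(r−m_q) ≤ 1`). Pure real inequalities;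
#16's locator `Step_12` is untouched. [cite: Xu2024NSLinfty, (3.53)–(3.54) p.16–17; (3.65) p.19] -/
theorem step_9_holds : Step_9 := by
  intro N q η j K f L hF h346
  have hP := hF.params
  have hFp := hF.fprops
  have hlam : 0 < lam N := hP.lam_pos
  have hq : (N : ℝ) + 2 < q := hP.q_gt
  have h2lam : 2 * lam N < (N : ℝ) + 2 := hP.two_lam_lt
  have hN3 : (3 : ℝ) ≤ N := by exact_mod_cast hP.three_le
  have hqpos : 0 < q := by linarith
  have hqlam : 0 < q - lam N := by linarith
  have hqj : q < j := hP.q_lt_j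
  have hmq2q : mq N q < 2 * q := hP.mq_lt
  have hmq_gt : (N : ℝ) + 2 < mq N q := hP.mq_gt
  have hmq0 : 0 < mq N q := by linarith
  have h2qmq : 0 < 2 * q - mq N q := by linarith
  have hcq : 0 < cq N q := hP.cq_pos
  have hη : 0 < η := hP.eta_pos
  -- `ln(8√N) > 0`
  have hl8 : 0 < Real.log (8 * Real.sqrt N) := by
    apply Real.log_pos
    have : 1 ≤ Real.sqrt N := Real.one_le_sqrt.mpr (by linarith)
    linarith
  set F₀ : ℝ := f (2 * lam N) / (2 * lam N) with hF₀
  set X : ℝ := Real.log (K (mq N q / 2)) with hX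
  have hF₀' : f (2 * lam N) = 2 * lam N * F₀ := by
    rw [hF₀]
    field_simp
  -- the `r`-uniform bound of the `X + cq·F₀` part of (3.46), `r ≥ 2q`
  have key : ∀ r, 2 * q ≤ r →
      (X + cq N q * F₀) / (r - mq N q) ≤ max X 0 / (2 * q - mq N q) + cq N q / (2 * q - mq N q) * max F₀ 0 := by
    intro r hr
    have hrmq : 0 < r - mq N q := by linarith
    have hle : 2 * q - mq N q ≤ r - mq N q := by linarith
    rw [add_div]
    apply add_le_add (Step9Proof.div_le_max_div hmq2q hr)
    have h1 : F₀ / (r - mq N q) ≤ max F₀ 0 / (2 * q - mq N q) :=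
      (div_le_div_of_nonneg_right (le_max_left F₀ 0) hrmq.le).trans
        (div_le_div_of_nonneg_left (le_max_right F₀ 0) h2qmq hle)
    calc cq N q * F₀ / (r - mq N q) = cq N q * (F₀ / (r - mq N q)) := by ring
      _ ≤ cq N q * (max F₀ 0 / (2 * q - mq N q)) := mul_le_mul_of_nonneg_left h1 hcq.le
      _ = cq N q / (2 * q - mq N q) * max F₀ 0 := by ring
  -- (3.46) split: `L ≤ ln(8√N) + (X + cq F₀)/(r − m_q) + f(r)/(r − m_q)`
  have h346' : ∀ r, mq N q < r →
      L ≤ Real.log (8 * Real.sqrt N) + (X + cq N q * F₀) / (r - mq N q) + f r / (r - mq N q) := by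
    intro r hr
    have h := h346 r hr
    rw [add_div] at h
    linarith
  refine ⟨fun h353 => ?_, fun h354 => ?_, fun h365 => ?_⟩
  · -- ¬(3.53): some `s ≥ 2q` with `f(s) ≤ 0` (p. 16 l. 10–25)
    simp only [Pos353, not_forall, not_lt] at h353
    obtain ⟨s, hs, hfs⟩ := h353
    have hsmq : 0 < s - mq N q := by linarith
    have hb := h346' s (by linarith)
    have hfs' : f s / (s - mq N q) ≤ 0 := div_nonpos_of_nonpos_of_nonneg hfs hsmq.le
    have hk := key s hs
    linarith
  · -- ¬(3.54): some `r ≥ 2q` with `r f′(r) ≤ f(r)`; by (3.14) `f(r) ≤ r·f(2λ_N)/(2λ_N)` (p. 16–17)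
    simp only [Mono354, not_forall, not_lt] at h354
    obtain ⟨r, hr, hfr⟩ := h354
    have hrpos : 0 < r := by linarith
    have hr2lam : 2 * lam N < r := by linarith
    have hrmq : 0 < r - mq N q := by linarith
    -- (3.14): the chord from `2λ_N` lies below the tangent slope, which is `≤ f(r)/r`
    have h314 := hFp.slope_le_deriv r hr2lam
    have hder : deriv f r ≤ f r / r := by
      rw [le_div_iff₀ hrpos]
      linarith [mul_comm r (deriv f r)]
    have hch : (f r - f (2 * lam N)) / (r - 2 * lam N) ≤ f r / r := h314.trans hder
    rw [div_le_div_iff₀ (by linarith) hrpos] at hch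
    have hfrF : f r ≤ r * F₀ := by
      rw [hF₀'] at hch
      have h2 : 2 * lam N * f r ≤ 2 * lam N * (r * F₀) := by nlinarith
      exact le_of_mul_le_mul_left h2 (by linarith)
    have hb := h346' r (by linarith)
    have h3 : f r / (r - mq N q) ≤ r * F₀ / (r - mq N q) := div_le_div_of_nonneg_right hfrF hrmq.le
    have h4 := Step9Proof.mul_div_le_max (F := F₀) hmq0 hmq2q hr
    have hk := key r hr
    have h5 : cq N q / (2 * q - mq N q) * max F₀ 0 + 2 * q / (2 * q - mq N q) * max F₀ 0
        = (cq N q + 2 * q) / (2 * q - mq N q) * max F₀ 0 := by ring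
    linarith
  · -- ¬(3.65): some `r > 2j` with `η f(r)/(2(q−λ_N)(r−2j)) < ln(8√N)` (p. 19 l. 8–16)
    simp only [Small365, not_forall, not_le] at h365
    obtain ⟨r, hr, hfr⟩ := h365
    have hr2q : 2 * q ≤ r := by linarith
    have hrj : 0 < r - 2 * j := by linarith
    have hrmq : 0 < r - mq N q := by linarith
    have hden : 0 < 2 * (q - lam N) * (r - 2 * j) := by positivity
    have hfr' : f r ≤ Real.log (8 * Real.sqrt N) * (2 * (q - lam N) * (r - 2 * j)) / η := by
      rw [le_div_iff₀ hη]
      have := (div_lt_iff₀ hden).mp hfr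
      linarith
    have hb := h346' r (by linarith)
    have h3 : f r / (r - mq N q)
        ≤ Real.log (8 * Real.sqrt N) * (2 * (q - lam N) * (r - 2 * j)) / η / (r - mq N q) :=
      div_le_div_of_nonneg_right hfr' hrmq.le
    have hratio : (r - 2 * j) / (r - mq N q) ≤ 1 := by
      rw [div_le_one hrmq]
      linarith
    have hC : 0 ≤ Real.log (8 * Real.sqrt N) * (2 * (q - lam N)) / η := by positivity
    have h4 : Real.log (8 * Real.sqrt N) * (2 * (q - lam N) * (r - 2 * j)) / η / (r - mq N q)
        ≤ Real.log (8 * Real.sqrt N) * (2 * (q - lam N)) / η := by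
      calc Real.log (8 * Real.sqrt N) * (2 * (q - lam N) * (r - 2 * j)) / η / (r - mq N q)
          = Real.log (8 * Real.sqrt N) * (2 * (q - lam N)) / η * ((r - 2 * j) / (r - mq N q)) := by
            field_simp
        _ ≤ Real.log (8 * Real.sqrt N) * (2 * (q - lam N)) / η * 1 :=
            mul_le_mul_of_nonneg_left hratio hC
        _ = Real.log (8 * Real.sqrt N) * (2 * (q - lam N)) / η := mul_one _
    have hk := key r hr2q
    have h5 : Real.log (8 * Real.sqrt N) + Real.log (8 * Real.sqrt N) * (2 * (q - lam N)) / η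
        = Real.log (8 * Real.sqrt N) * (1 + 2 * (q - lam N) / η) := by
      field_simp
    linarith

/-! ## Records-grade print locator inside (3.72) (ns-claims-typist-10 g5, 2026-08-27; APPEND-ONLY; a TRUE
algebraic identity about two printed expressions — no step is asserted or refuted here, #16's locator `Step_12`
stands). The display defining `β_ε` on p. 20 (after (3.72)) prints two expressions joined by «=»:
LINE 1 `β_ε = r/(r−2j)·{(1/r + 2jε/(r(r−2j)))·B + 1 − (j−m_q−η)/(2(q−λ_N))}` (this IS the exponent produced by
inserting (3.71) into (3.66), `B` = `bracket`) and LINE 2 `2jεB/(r−2j)² + (1/(r−2j))·(r − j − (2q(j−m_q) − η)/(2(q−λ_N)))`,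
from which «lim_{ε→0⁺} β_ε = 1» and the p. 21 exponent limit (hence `theta`) are read off. Expanding LINE 1 gives
`… + r·η/(2(q−λ_N))` where LINE 2 has `… + η/(2(q−λ_N))`: the two lines differ by `η(r−1)/(2(q−λ_N)(r−2j))`. -/

/-- **The two printed lines of the `β_ε` display (p. 20, after (3.72)) differ by `η(r−1)/(2(q−λ_N)(r−2j))`**
(so they agree only at `η = 0` or `r = 1 < 2j`): with `B = bracket N q j r`,
`r/(r−2j)·((1/r + 2jε/(r(r−2j)))·B + 1 − (j−m_q−η)/(2(q−λ_N))) − (2jεB/(r−2j)² + (r − j − (2q(j−m_q)−η)/(2(q−λ_N)))/(r−2j))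
 = η(r−1)/(2(q−λ_N)(r−2j))`. Pure `field_simp`/`ring`; recorded for the verdict table of #16 (downstream of the
head `Step_12`; `Step_13` types the p. 21 conclusion drawn from LINE 2). [cite: Xu2024NSLinfty, display after (3.72) p.20; p.21 l.1–12] -/
theorem beta372_line1_sub_line2 {N : ℕ} {q j η ε r : ℝ} (hr : r ≠ 0) (hrj : r - 2 * j ≠ 0)
    (hql : q - lam N ≠ 0) :
    r / (r - 2 * j) * ((1 / r + 2 * j * ε / (r * (r - 2 * j))) * bracket N q j r
        + 1 - (j - mq N q - η) / (2 * (q - lam N)))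
      - (2 * j * ε / (r - 2 * j) ^ 2 * bracket N q j r
          + 1 / (r - 2 * j) * (r - j - (2 * q * (j - mq N q) - η) / (2 * (q - lam N))))
      = η * (r - 1) / (2 * (q - lam N) * (r - 2 * j)) := by
  unfold bracket
  field_simp
  ring

/-- Consequently LINE 1 (the exponent actually produced by (3.66)+(3.71)) equals
`2jεB/(r−2j)² + (r·(1 + η/(2(q−λ_N))) − j − 2q(j−m_q)/(2(q−λ_N)))/(r−2j)` — the `η`-term carries the factor `r`.
[cite: Xu2024NSLinfty, display after (3.72) p.20] -/
theorem beta372_line1_eq {N : ℕ} {q j η ε r : ℝ} (hr : r ≠ 0) (hrj : r - 2 * j ≠ 0)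
    (hql : q - lam N ≠ 0) :
    r / (r - 2 * j) * ((1 / r + 2 * j * ε / (r * (r - 2 * j))) * bracket N q j r
        + 1 - (j - mq N q - η) / (2 * (q - lam N)))
      = 2 * j * ε / (r - 2 * j) ^ 2 * bracket N q j r
          + (r * (1 + η / (2 * (q - lam N))) - j - 2 * q * (j - mq N q) / (2 * (q - lam N))) / (r - 2 * j) := by
  unfold bracket
  field_simp
  ring

end

end Literature.Claims.NS.Xu2024
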